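import Summits.HodgeConjecture.HodgeConjecture.Theorems.F0P3cStCharTSUpTrAssemblyCore      -- ★ (A1′)-E p852534: the letters `SH n γc eT heT tH dG dH` (by shape), the (UP-DEF) inline spelling; brings ★ (A1′)-D `isLocalGRegular_iff_isRegularElt_of_isLocalNormPair`, ★ `finKappaAt_conj_right`
import Summits.HodgeConjecture.HodgeConjecture.Theorems.F0P3cStCharTSUpTrClaimPRadical    -- ★ (F3) p852584 (this seat): brings ★ (P3) `isLocalNormPair_of_isConj_right`, ★ UP-EVAL `finsum_quot_eq_sum`, ★ (H3b) `centralizer_eq_cartan_of_isLocalGRegular`, ★ stable invariance of `τ`, `κ`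
import HarnessLib

/-!
# (E8) «ELL-INNER ASSEMBLY» — the BODY (map owner LH6-p03 (g7) DEAL 2026-09-02T20:09:57Z «(E8) BODY → p06»; sigsheet of record v1 2491f5c6fae33558, v2 = its USED letters) + the (β) SCALAR LEMMA
# «WEIGHTS GATE before bodies of (E0)∕(E8)»: `h1252` from (E0) + (E2)∕(E2b) + (E3) + (E4) + (E6) + (E7) with NO further analytic input
# [Rogawski1990 §12.5 Prop. 12.5.2 pp. 183–185; Lemma 12.5.1; §3.6 Lemma 3.6.1; §3.7 Prop. 3.7.1]

Seat F0P3a-p06 (g23) ((P3)∕(N5) lineage), crux H413 = `stmt-HodgeConjecture-24833`; ROAD «ELL-INNER» (CHARTER-IN-PRINCIPLE T14-40; map owner ∕ holder-designate LH6-p03 (g7), CENSUS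
«1252 ∕ ELL-INNER» v1 06afd1d3d7b1895d; (E0) sigsheet v1 d79153e6d088e7cb).  THEOREMS ONLY (no definition ∕ instance ∕ notation ∕ named fact ∕ `sorry`); ★-only imports; axioms TRIO; lane `--supports … --as helper`, count-neutral.  §1 = the (β) scalar lemma
(LEAD T14-40, PASSED 20:08:34Z), §2 = two algebra helpers, §3 = the assembly theorem PROVED from its letters (v2 = v1 minus the letters the proof does not read: the
`G`-side property hypotheses `hcartO hcovGO hncGO hHaarGO hcoreGO`, `hγc hexh hinj hcomplete hirred htHh htH`, `Measurable α₁∕α₂∕Φ` — all of them (E0)'s own inputs, consumed there).  HONEST LABEL: `𝔇.Prop1252` stays a PRINTED consequent of `hBlock′` until a ★ rider;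
HC_CM is proved only modulo the 7 printed citations (2 remaining: hLiu418 = `stmt-HodgeConjecture-24832`, h413 = `stmt-HodgeConjecture-24833`) until rung 0 closes.

## THE TARGET, TOKEN FOR TOKEN
`h1252` (★ RUNG0 v8 `F0P3cStCharTSRung0Eight` :268) IS `𝔇.Prop1252` (★ `Ch12Sec5` :141–:145):
`∀ α₁ α₂, Measurable α₁ → Measurable α₂ → IsStableClassFunOn 𝔇.stConjH 𝔇.ellH α₁ → IsStableClassFunOn 𝔇.stConjH 𝔇.ellH α₂ → 𝔇.InnerGDefined (𝔇.up α₁) (𝔇.up α₂) → 𝔇.InnerHDefined α₁ α₂ →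
 𝔇.innerG (𝔇.up α₁) (𝔇.up α₂) = 2 * 𝔇.innerH α₁ α₂`, with (★ `Ch12Sec5Defs` :235–:243, :77)
`innerG β₁ β₂ = Σ_{T ∈ 𝔇.cartanG} (weylOrder T : ℂ)⁻¹ * ∫_{↥T} (𝔇.DG t : ℂ)^2 * β₁ t * conj (β₂ t) ∂(𝔇.μT T)`, `innerH` the same over `𝔇.cartanH` with `𝔇.DH`, `𝔇.μTH`,
`weylOrder T = Nat.card (N(T) ⧸ T.subgroupOf N(T))` (= `(T.subgroupOf (normalizer ↑T)).index` by `rfl`, `Subgroup.index := Nat.card _`).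
UNDER THE PINS of `hBlock′` (★ R8 :149–:212) `eCartanG : 𝔇.cartanG = Sell`, `eMuT : ∀ T′, 𝔇.μT T′ = μTf T′`, `eCartanH : 𝔇.cartanH = SH`, `eMuTH : ∀ T, 𝔇.μTH T = μTHf T`, `eDG`, `eDH`
(closed radicals), `hUp` (THE (UP-DEF) formula), `hStH : 𝔇.stConjH ↔ IsLocalStablyConjH`, `eEllH : a ∈ 𝔇.ellH ↔ IsLocalGRegular a ∧ IsCompact Z_H(a)`, the target rewrites to the
CONCRETE sentence of §2 below — exactly as ★ (P1) `F0P3cStCharTSUpTrDatumDict` docked `hUpTr` to ★ (A1′)-E∕F: `dG`∕`dH` abstract closed forms (E's letters), `tH` for `μTHf` on `SH`,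
`μTf` on `Sell`, `up α` INLINED by (UP-DEF).  The (E9) dock is therefore pin rewriting only (no analysis), as for UP-TR.

## THE INPUTS BY SHAPE (each = the CONCLUSION of one banked∕★ brick; none is analytic beyond the two GIVEN totals)
* (E0) G-REGROUP — `hE0` = the conclusion of the (E0) sigsheet v1 (LH6-p03), quantified over its `Φ`-letters only, at THIS file's system letters, with its new count letter `cQ`
  realised by the SLOT MAPS `σ T u` of (E2)∕(E2b) (so `hcQ` is discharged by `Q := image (u ↦ σ T u s)`, `card = cQ T` from `hσpair`); plus its TRANSPORT COMPANION `hE0i`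
  (integrability of `Φ ∘ eT T i` on `T^{G-reg}` DERIVED inside (E0) from `hΦi` by whole-integrand transport along `eT` — ★ (A1′)-D — fence (γ): it is a CONCLUSION of (E0),
  never an assumption on pieces of the final theorem);
* (E2) FIBRE-ENUM + (E2b) SLOT-AUT — `σ : (T : Subgroup H_v) → Fin (cQ T) → (↥T → ↥T)` with `hσm` (each `σ T u` PRESERVES `tH T`), `hσreg` (preserves `G`-regularity), `hσR`
  (`σ T u s ↔ eT T i s` for every `i`), `hσpair` (distinct slots are NOT stably conjugate), `hσexh` (every `G`-regular `a ↔ eT T i s` is stably conjugate to some slot) —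
  i.e. `{[σ T u s]_st}` IS a transversal of the `G`-regular stable norm fibre of `eT T i s`, the same for all `i` [R90 §3.7 Prop. 3.7.1; (E2): `cQ` = 3 ∕ 1 by torus type];
* (E3) UNIT WEIGHTS — `hτ : τ(q) · conj τ(q) = 1` at `G`-regular `q` (unitary `μ`; ★ `norm_finTau_le_one` + unitarity);
* (E4) CROSS, in `(T, i)` letters — `hcross` (`u ≠ u′ ⇒ Σ_i κ(σ_u s, e_i s) κ(σ_{u′} s, e_i s) = 0`) and `hdiag` (`Σ_i κ(σ_u s, e_i s)² = n T`): ★ p852562's three heads read through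
  the (N2b′)∕(X2) bijection `i ↦ [eT T i s]` onto `conjClassesIn [x]_st` (`hexh`∕`hinj`) — the (E4′) re-lettering brick, S;
* (E6) INDEX TWO — `hnm : n T = 2 * m T` on `SH` [R90 §3.6 L. 3.6.1: `|𝔇_H(T∕F)| = 2 |𝔇(T∕F)|`]; `m ≠ 0` is READ from `hclasses` (the transversal of the stable class of `s ∋` a conjugate of `s`);
* (E7) MEASURES — here only `hsingH`: the `G`-singular part of each `T ∈ SH` is `tH T`-null (★ (H2) SINGULAR-NULL-H p852354 + compact-torus Haar; F0P2-p02's (E7) file carries the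
  `μTHf = tH`∕probability∕`weylOrder = index` identifications used by the (E9) dock, not by this concrete sentence);
* the (UP-DEF) currency letters of ★ (A1′)-E: `dG` class function with `hdG0 : dG ≠ 0` at regular points (closed form: `disc ≠ 0`), `dH` with `hDHst` (★ p852584 §1
  `radicalH_eq_of_isLocalStablyConjH` pays it for the closed radical), UP-EVAL's transversal formula ★ `finsum_upSummand_eq_sum` (used IN the body, not a letter);
* the two GIVEN totals (Prop1252's antecedents under the pins): `hIG` (= `InnerGDefined (up α₁) (up α₂)` on `Sell`, integrand spelled inline) and `hIH` (= `InnerHDefined α₁ α₂` on `SH`),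
  and `α₁ α₂` measurable, STABLE CLASS FUNCTIONS ON THE `G`-REGULAR ELLIPTIC SET ONLY (= `IsStableClassFunOn 𝔇.stConjH 𝔇.ellH` under `hStH`∕`eEllH`; census wall (d)(4): every
  `q` read is in the norm fibre of an elliptic regular `x`, hence elliptic — ★ (Θ) `exists_localEndoCentralizerEquiv_normPair`).

## THE BODY (for the charter; ≈ 200 l. once (E0) is ★): `Φ := dG² · upC α₁ · conj (upC α₂)` is a class function on `G` (★ `finKappaAt_conj_right`, ★ `isLocalNormPair_of_isConj_right`,
`hdG`), vanishes off the matched regular set (the (UP-DEF) indicators), integrable on `Sell` (`hIG`) ⇒ `hE0`; pointwise at `x = eT T i s` (`s` `G`-regular): UP-EVAL on the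
transversal `{σ_u s}` (`hσR hσpair hσexh`, stability of `τ·dH·κ·α` on the fibre) gives `upC α x = (dG x)⁻¹ Σ_u τ_u dH_u κ(σ_u s, x) α(σ_u s)`, so (with `hdG0`, `dG` real)
`Φ(x) = Σ_{u,u′} τ_u conj τ_{u′} · dH_u dH_{u′} · κ(σ_u s, x) κ(σ_{u′} s, x) · α₁(σ_u s) conj α₂(σ_{u′} s)`; `Σ_i` under the integral by `hE0i`; `hcross`∕`hdiag` kill `u ≠ u′` and give
`n T · Σ_u |τ_u|² dH_u² α₁(σ_u s) conj α₂(σ_u s)` = (`hτ`) `n T · Σ_u F(σ_u s)` with `F := dH² α₁ conj α₂` (integrable on `T` by `hIH`); `hσm` + `hσreg`: `∫_{T^{G-reg}} F ∘ σ_u = ∫_{T^{G-reg}} F`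
(each `F ∘ σ_u` integrable by `MeasurePreserving.integrable_comp` — no piece assumed); `hsingH`: `∫_{T^{G-reg}} F = ∫_T F`; scalars: §1 `([N_H(T):T])⁻¹ (m T)⁻¹ (cQ T)⁻¹ · (cQ T · n T) = 2 ([N_H(T):T])⁻¹`.
WEIGHTS CHECK (LEAD (β), BOTH types, nothing hard-coded): type (1) `m = 2, n = 4, cQ = 3`: `(1∕|W_H|)·½·⅓·3·4 = 2∕|W_H|` ✓; type (2) `m = 1, n = 2, cQ = 1`: `(1∕|W_H|)·1·1·1·2 = 2∕|W_H|` ✓ —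
§1 is the uniform statement; `|W_H(T)|` is never evaluated (F0P2-p02 19:59:47Z (1): `|W_H| = 1` occurs when `−1 ∉ N(E_w^×)`).

## References
* [Rogawski1990] J. D. Rogawski, *Automorphic Representations of Unitary Groups in Three Variables*, Ann. of Math. Stud. 123 (1990): §12.5 pp. 182–185 (Lemma 12.5.1,
  Prop. 12.5.2 and its proof), §3.6 Lemma 3.6.1 p. 31, §3.7 Prop. 3.7.1 p. 31, §4.3 (4.3.2) p. 42, §4.9 p. 55.
* [LanglandsShelstad1987] R. P. Langlands, D. Shelstad, *On the definition of transfer factors*, Math. Ann. 278 (1987), §1.3.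
-/

set_option autoImplicit false
-- the mandated namespace has the single-problem summit's repeated segment (`HodgeConjecture.HodgeConjecture`)
set_option linter.dupNamespace false

noncomputable section

open MeasureTheory Measure Set Filter Topology Function NumberField IsDedekindDomain Matrix
open Literature.MeasureTheory.Group
open Literature.NumberTheory.Automorphic Literature.NumberTheory.Automorphic.UnitaryGroup Literature.NumberTheory.Rogawski1990
open Literature.NumberTheory.GaloisRepresentations
open Summit.HodgeConjecture.HodgeConjecture.Cruxes.H413
open Summit.HodgeConjecture.HodgeConjecture.Cruxes.H413.F0P3cStCharTSWeylCartanRadial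
open Summit.HodgeConjecture.HodgeConjecture.Cruxes.H413.F0P3cStCharTSUpTrExchange
open Summit.HodgeConjecture.HodgeConjecture.Cruxes.H413.F0P3cStCharTSUpEval
open scoped ENNReal NNReal MatrixGroups Pointwise Classical

namespace Summit.HodgeConjecture.HodgeConjecture.Cruxes.H413.F0P3cStCharTSEllInnerAssembly

/-! ## §1 The (β) scalar lemma — the printed factor `2`, both torus types in ONE statement -/

/-- **THE PRINTED FACTOR `2` (LEAD T14-40 fence (β)).**  For a member `T ∈ SH` with Weyl index `W = [N_H(T):T]`, `m` = #(`H_v`-classes in a `G`-regular stable class meeting `T`),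
`c` = #(stable norm-fibre of its `G`-partners), `n` = #(`G`-classes over it) and Lemma 3.6.1's `n = 2·m`:
`W⁻¹ · m⁻¹ · c⁻¹ · (c · n) = 2 · W⁻¹` — type (1): `(m, n, c) = (2, 4, 3)`; type (2): `(1, 2, 1)`; `W` is never evaluated (it may be `1` or `2`). [cite: Rogawski1990, §3.6 Lemma 3.6.1 p. 31; §12.5 p. 185] -/
theorem weight_mul_count_eq_two_mul (W m c n : ℕ) (hm : m ≠ 0) (hc : c ≠ 0) (hn : n = 2 * m) :
    ((W : ℂ))⁻¹ * ((m : ℂ))⁻¹ * ((c : ℂ))⁻¹ * ((c : ℂ) * (n : ℂ)) = 2 * ((W : ℂ))⁻¹ := by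
  subst hn
  have hm' : (m : ℂ) ≠ 0 := Nat.cast_ne_zero.2 hm
  have hc' : (c : ℂ) ≠ 0 := Nat.cast_ne_zero.2 hc
  push_cast
  field_simp

/-- The same with the count written as the sum it comes from: `W⁻¹ m⁻¹ c⁻¹ · Σ_{u : Fin c} n = 2 W⁻¹`. [cite: Rogawski1990, §12.5 p. 185] -/
theorem weight_mul_sum_const_eq_two_mul (W m c n : ℕ) (hm : m ≠ 0) (hc : c ≠ 0) (hn : n = 2 * m) :
    ((W : ℂ))⁻¹ * ((m : ℂ))⁻¹ * ((c : ℂ))⁻¹ * (∑ _u : Fin c, (n : ℂ)) = 2 * ((W : ℂ))⁻¹ := by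
  rw [Finset.sum_const, Finset.card_univ, Fintype.card_fin, nsmul_eq_mul]
  exact weight_mul_count_eq_two_mul W m c n hm hc hn

/-! ## §2 Two algebra helpers: the product of the two transversal sums, and the cross∕diagonal collapse -/

/-- `d² · (d⁻¹ A) · conj (d⁻¹ B) = A · conj B` for a non-zero REAL `d` (the Weyl radical `D_G` cancels against the two `D_G⁻¹` of `α₁^G`, `α₂^G`). [cite: Rogawski1990, §12.5 p. 184] -/
theorem sq_mul_inv_mul_mul_conj_inv_mul {d : ℝ} (hd : d ≠ 0) (A B : ℂ) :
    ((d : ℂ)) ^ 2 * (((d : ℂ))⁻¹ * A) * starRingEnd ℂ (((d : ℂ))⁻¹ * B) = A * starRingEnd ℂ B := by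
  have hd' : (d : ℂ) ≠ 0 := Complex.ofReal_ne_zero.2 hd
  rw [map_mul, map_inv₀, Complex.conj_ofReal]
  field_simp

/-- CROSS∕DIAGONAL COLLAPSE: if `K u u′ = 0` for `u ≠ u′` and `K u u = N`, then `Σ_u Σ_{u′} c u u′ · K u u′ = N · Σ_u c u u`. [cite: Rogawski1990, §12.5 p. 185] -/
theorem sum_sum_mul_eq_mul_sum_diag {ι : Type*} [Fintype ι] [DecidableEq ι] (c K : ι → ι → ℂ) (N : ℂ)
    (h0 : ∀ u u', u ≠ u' → K u u' = 0) (hd : ∀ u, K u u = N) :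
    ∑ u, ∑ u', c u u' * K u u' = N * ∑ u, c u u := by
  rw [Finset.mul_sum]
  refine Finset.sum_congr rfl fun u _ => ?_
  rw [Finset.sum_eq_single u (fun u' _ hne => by rw [h0 u u' (Ne.symm hne), mul_zero]) (fun h => absurd (Finset.mem_univ u) h), hd u, mul_comm]

/-! ## §3 The (E8) assembly -/

section CM

variable (L : Type) [Field L] [NumberField L] [IsCMField L] (v : HeightOneSpectrum (𝓞 ↥(maximalRealSubfield L)))

set_option maxHeartbeats 3200000 in
set_option synthInstance.maxHeartbeats 400000 in
-- long statement; instance-term unification on the CM local carriers (class of ★ (A1′)-E)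
/-- **(E8) «ELL-INNER ASSEMBLY FROM NAMED INPUTS».**  Conclusion = `𝔇.innerG (𝔇.up α₁) (𝔇.up α₂) = 2 * 𝔇.innerH α₁ α₂` READ THROUGH THE PINS (module docstring):
`Σ_{T′ ∈ Sell} [N_G(T′):T′]⁻¹ ∫_{T′} dG² · upC α₁ · conj (upC α₂) ∂μTf = 2 · Σ_{T ∈ SH} [N_H(T):T]⁻¹ ∫_T dH² · α₁ · conj α₂ ∂tH`, `upC` = (UP-DEF) inline.  Inputs BY SHAPE = the conclusions of
(E0) (`hE0`, with its transport companion `hE0i`), (E2)∕(E2b) (`σ hσm hσreg hσR hσpair hσexh`), (E3) `hτ`, (E4) in `(T,i)` letters (`hcross hdiag`), (E6) `hnm`, (E7) `hsingH`, the two GIVEN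
totals `hIG hIH`, the stable-class-function letters `hα₁st hα₂st` on the `G`-regular ELLIPTIC set, and ★ (A1′)-E's currency letters `hdG hdG0 hDHst heT hZ hKH hclasses`.  PROOF: `hE0` at
`Φ := dG²·upC α₁·conj(upC α₂)` (a class function by ★ `finKappaAt_conj_right` ∕ `isLocalNormPair_of_isConj_right` ∕ `hdG`, vanishing off the matched set by the (UP-DEF) indicators);
per `T ∈ SH`: the `G`-singular part is `tH`-null (`hsingH`) so set integrals are full integrals; `Σ_i` under `∫` by `hE0i`; pointwise at `x = e_{T,i} s` UP-EVAL (★ `finsum_quot_eq_sum`)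
on the slot transversal `{σ_u s}` — the summand is stable because every fibre point is stably conjugate to a slot, a `G`-regular point of the COMPACT Cartan `T` (`hKH`, ★
`centralizer_eq_cartan_of_isLocalGRegular`), where `hα·st` applies; §2 expands `dG²·(dG⁻¹Σ)·conj(dG⁻¹Σ)`; `hcross`∕`hdiag` collapse `Σ_i`; `hτ`; each `∫_T F∘σ_u = ∫_T F` by `hσm`
(`integral_map`, `MeasurePreserving.integrable_comp` — no piece integrability assumed, fence (γ)); §1 closes the scalars. [cite: Rogawski1990, §12.5 Prop. 12.5.2 pp. 183–185]
[cite: LanglandsShelstad1987, §1.3] -/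
theorem innerG_up_eq_two_mul_innerH_of_inputs
    [MeasurableSpace (Gqs L v)] [BorelSpace (Gqs L v)]
    [MeasurableSpace ((UnitaryGroup.cmDatum L 2 (Matrix.of fun i j : Fin 2 => if i.val + j.val + 1 = 2 then (1 : L) else 0)).Local v × (UnitaryGroup.cmDatum L 1 (Matrix.of fun i j : Fin 1 => if i.val + j.val + 1 = 1 then (1 : L) else 0)).Local v)] [BorelSpace ((UnitaryGroup.cmDatum L 2 (Matrix.of fun i j : Fin 2 => if i.val + j.val + 1 = 2 then (1 : L) else 0)).Local v × (UnitaryGroup.cmDatum L 1 (Matrix.of fun i j : Fin 1 => if i.val + j.val + 1 = 1 then (1 : L) else 0)).Local v)]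
    (μ : HeckeCharacter L)
    -- the closed forms, abstract (★ (A1′)-E letters) — `dG` a real class function, non-zero at regular points; `dH` stable on `G`-regular classes (★ p852584 §1 for the closed radical)
    (dG : Gqs L v → ℝ) (hdG : ∀ h g : Gqs L v, dG (h * g * h⁻¹) = dG g) (hdG0 : ∀ t : Gqs L v, IsRegularElt ((t).val : GL (Fin 3) (UnitaryGroup.LocalRing L v)) → dG t ≠ 0)
    (dH : ((UnitaryGroup.cmDatum L 2 (Matrix.of fun i j : Fin 2 => if i.val + j.val + 1 = 2 then (1 : L) else 0)).Local v × (UnitaryGroup.cmDatum L 1 (Matrix.of fun i j : Fin 1 => if i.val + j.val + 1 = 1 then (1 : L) else 0)).Local v) → ℝ) (hDHst : ∀ a b, IsLocalGRegular L v a → IsLocalStablyConjH L v a b → dH b = dH a)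
    -- the `H`-Cartan system with embeddings and torus measures (★ (A1′)-E∕E′ letters; (H1), (X2)∕(N2b′))
    (SH : Finset (Subgroup ((UnitaryGroup.cmDatum L 2 (Matrix.of fun i j : Fin 2 => if i.val + j.val + 1 = 2 then (1 : L) else 0)).Local v × (UnitaryGroup.cmDatum L 1 (Matrix.of fun i j : Fin 1 => if i.val + j.val + 1 = 1 then (1 : L) else 0)).Local v))) (n : Subgroup ((UnitaryGroup.cmDatum L 2 (Matrix.of fun i j : Fin 2 => if i.val + j.val + 1 = 2 then (1 : L) else 0)).Local v × (UnitaryGroup.cmDatum L 1 (Matrix.of fun i j : Fin 1 => if i.val + j.val + 1 = 1 then (1 : L) else 0)).Local v) → ℕ)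
    (γc : (T : Subgroup ((UnitaryGroup.cmDatum L 2 (Matrix.of fun i j : Fin 2 => if i.val + j.val + 1 = 2 then (1 : L) else 0)).Local v × (UnitaryGroup.cmDatum L 1 (Matrix.of fun i j : Fin 1 => if i.val + j.val + 1 = 1 then (1 : L) else 0)).Local v)) → Fin (n T) → Gqs L v)
    (eT : (T : Subgroup ((UnitaryGroup.cmDatum L 2 (Matrix.of fun i j : Fin 2 => if i.val + j.val + 1 = 2 then (1 : L) else 0)).Local v × (UnitaryGroup.cmDatum L 1 (Matrix.of fun i j : Fin 1 => if i.val + j.val + 1 = 1 then (1 : L) else 0)).Local v)) → (i : Fin (n T)) → (↥T ≃ₜ* ↥(Subgroup.centralizer ({γc T i} : Set (Gqs L v)))))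
    (heT : ∀ T ∈ SH, ∀ (i : Fin (n T)) (s : ↥T), IsLocalNormPair L (qsForm L) v s.1 ((eT T i s : ↥(Subgroup.centralizer ({γc T i} : Set (Gqs L v)))) : Gqs L v))
    (tH : (T : Subgroup ((UnitaryGroup.cmDatum L 2 (Matrix.of fun i j : Fin 2 => if i.val + j.val + 1 = 2 then (1 : L) else 0)).Local v × (UnitaryGroup.cmDatum L 1 (Matrix.of fun i j : Fin 1 => if i.val + j.val + 1 = 1 then (1 : L) else 0)).Local v)) → Measure ↥T)
    (hZ : ∀ T ∈ SH, ∃ γ₀ : ((UnitaryGroup.cmDatum L 2 (Matrix.of fun i j : Fin 2 => if i.val + j.val + 1 = 2 then (1 : L) else 0)).Local v × (UnitaryGroup.cmDatum L 1 (Matrix.of fun i j : Fin 1 => if i.val + j.val + 1 = 1 then (1 : L) else 0)).Local v), IsLocalGRegular L v γ₀ ∧ T = Subgroup.centralizer ({γ₀} : Set ((UnitaryGroup.cmDatum L 2 (Matrix.of fun i j : Fin 2 => if i.val + j.val + 1 = 2 then (1 : L) else 0)).Local v × (UnitaryGroup.cmDatum L 1 (Matrix.of fun i j : Fin 1 =>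 if i.val + j.val + 1 = 1 then (1 : L) else 0)).Local v)))
    (hKH : ∀ T ∈ SH, IsCompact (T : Set ((UnitaryGroup.cmDatum L 2 (Matrix.of fun i j : Fin 2 => if i.val + j.val + 1 = 2 then (1 : L) else 0)).Local v × (UnitaryGroup.cmDatum L 1 (Matrix.of fun i j : Fin 1 => if i.val + j.val + 1 = 1 then (1 : L) else 0)).Local v)))
    -- (H6a′) class counts, BY SHAPE
    (m : Subgroup ((UnitaryGroup.cmDatum L 2 (Matrix.of fun i j : Fin 2 => if i.val + j.val + 1 = 2 then (1 : L) else 0)).Local v × (UnitaryGroup.cmDatum L 1 (Matrix.of fun i j : Fin 1 => if i.val + j.val + 1 = 1 then (1 : L) else 0)).Local v) → ℕ)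
    (hclasses : ∀ T ∈ SH, ∀ s ∈ T, IsLocalGRegular L v s →
      ∃ C : Finset ((UnitaryGroup.cmDatum L 2 (Matrix.of fun i j : Fin 2 => if i.val + j.val + 1 = 2 then (1 : L) else 0)).Local v × (UnitaryGroup.cmDatum L 1 (Matrix.of fun i j : Fin 1 => if i.val + j.val + 1 = 1 then (1 : L) else 0)).Local v), (∀ x ∈ C, IsLocalStablyConjH L v s x) ∧ (∀ x ∈ C, ∀ y ∈ C, IsConj x y → x = y) ∧ (∀ y, IsLocalStablyConjH L v s y → ∃ x ∈ C, IsConj y x) ∧ C.card = m T)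
    -- the `G`-side elliptic Cartan system (data only; its properties are (E0)'s inputs)
    (Sell : Finset (Subgroup (Gqs L v))) (μTf : (T' : Subgroup (Gqs L v)) → Measure ↥T')
    -- (E2) FIBRE-ENUM ∕ (E2b) SLOT-AUT: the stable norm fibre over `eT T i s` is enumerated by `cQ T` slot maps of `T`, measure-preserving, the same for every `i`
    (cQ : Subgroup ((UnitaryGroup.cmDatum L 2 (Matrix.of fun i j : Fin 2 => if i.val + j.val + 1 = 2 then (1 : L) else 0)).Local v × (UnitaryGroup.cmDatum L 1 (Matrix.of fun i j : Fin 1 => if i.val + j.val + 1 = 1 then (1 : L) else 0)).Local v) → ℕ) (σ : (T : Subgroup ((UnitaryGroup.cmDatum L 2 (Matrix.of fun i j : Fin 2 => if i.val + j.val + 1 = 2 then (1 : L) else 0)).Local v × (UnitaryGroup.cmDatum L 1 (Matrix.of fun i j : Fin 1 => if i.val + j.val + 1 = 1 then (1 : L) else 0)).Local v)) → Fin (cQ T) → (↥T → ↥T))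
    (hσm : ∀ T ∈ SH, ∀ u : Fin (cQ T), MeasurePreserving (σ T u) (tH T) (tH T))
    (hσreg : ∀ T ∈ SH, ∀ (u : Fin (cQ T)) (s : ↥T), IsLocalGRegular L v (s : ((UnitaryGroup.cmDatum L 2 (Matrix.of fun i j : Fin 2 => if i.val + j.val + 1 = 2 then (1 : L) else 0)).Local v × (UnitaryGroup.cmDatum L 1 (Matrix.of fun i j : Fin 1 => if i.val + j.val + 1 = 1 then (1 : L) else 0)).Local v)) → IsLocalGRegular L v (σ T u s : ((UnitaryGroup.cmDatum L 2 (Matrix.of fun i j : Fin 2 => if i.val + j.val + 1 = 2 then (1 : L) else 0)).Local v × (UnitaryGroup.cmDatum L 1 (Matrix.of fun i j : Fin 1 => if i.val + j.val + 1 = 1 then (1 : L) else 0)).Local v)))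
    (hσR : ∀ T ∈ SH, ∀ (u : Fin (cQ T)) (i : Fin (n T)) (s : ↥T), IsLocalGRegular L v (s : ((UnitaryGroup.cmDatum L 2 (Matrix.of fun i j : Fin 2 => if i.val + j.val + 1 = 2 then (1 : L) else 0)).Local v × (UnitaryGroup.cmDatum L 1 (Matrix.of fun i j : Fin 1 => if i.val + j.val + 1 = 1 then (1 : L) else 0)).Local v)) → IsLocalNormPair L (qsForm L) v (σ T u s).1 ((eT T i s : ↥(Subgroup.centralizer ({γc T i} : Set (Gqs L v)))) : Gqs L v))
    (hσpair : ∀ T ∈ SH, ∀ (s : ↥T), IsLocalGRegular L v (s : ((UnitaryGroup.cmDatum L 2 (Matrix.of fun i j : Fin 2 => if i.val + j.val + 1 = 2 then (1 : L) else 0)).Local v × (UnitaryGroup.cmDatum L 1 (Matrix.of fun i j : Fin 1 => if i.val + j.val + 1 = 1 then (1 : L) else 0)).Local v)) → ∀ u u' : Fin (cQ T), u ≠ u' → ¬ IsLocalStablyConjH L v (σ T u s).1 (σ T u' s).1)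
    (hσexh : ∀ T ∈ SH, ∀ (i : Fin (n T)) (s : ↥T), IsLocalGRegular L v (s : ((UnitaryGroup.cmDatum L 2 (Matrix.of fun i j : Fin 2 => if i.val + j.val + 1 = 2 then (1 : L) else 0)).Local v × (UnitaryGroup.cmDatum L 1 (Matrix.of fun i j : Fin 1 => if i.val + j.val + 1 = 1 then (1 : L) else 0)).Local v)) → ∀ a : ((UnitaryGroup.cmDatum L 2 (Matrix.of fun i j : Fin 2 => if i.val + j.val + 1 = 2 then (1 : L) else 0)).Local v × (UnitaryGroup.cmDatum L 1 (Matrix.of fun i j : Fin 1 => if i.val + j.val + 1 = 1 then (1 : L) else 0)).Local v), IsLocalGRegular L v a → IsLocalNormPair L (qsForm L) v a ((eT T i s : ↥(Subgroup.centralizer ({γc T i} : Set (Gqs L v)))) : Gqs L v) →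
      ∃ u : Fin (cQ T), IsLocalStablyConjH L v a (σ T u s).1)
    -- (E3) UNIT WEIGHTS
    (hτ : ∀ q : ((UnitaryGroup.cmDatum L 2 (Matrix.of fun i j : Fin 2 => if i.val + j.val + 1 = 2 then (1 : L) else 0)).Local v × (UnitaryGroup.cmDatum L 1 (Matrix.of fun i j : Fin 1 => if i.val + j.val + 1 = 1 then (1 : L) else 0)).Local v), IsLocalGRegular L v q → finTau L v q μ * starRingEnd ℂ (finTau L v q μ) = 1)
    -- (E4) CROSS and DIAGONAL in `(T, i)` letters
    (hcross : ∀ T ∈ SH, ∀ (s : ↥T), IsLocalGRegular L v (s : ((UnitaryGroup.cmDatum L 2 (Matrix.of fun i j : Fin 2 => if i.val + j.val + 1 = 2 then (1 : L) else 0)).Local v × (UnitaryGroup.cmDatum L 1 (Matrix.of fun i j : Fin 1 => if i.val + j.val + 1 = 1 then (1 : L) else 0)).Local v)) → ∀ u u' : Fin (cQ T), u ≠ u' →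
      ∑ i : Fin (n T), ((finKappaAt L v (qsForm L) (σ T u s).1 ((eT T i s : ↥(Subgroup.centralizer ({γc T i} : Set (Gqs L v)))) : Gqs L v) : ℤ) : ℂ) * ((finKappaAt L v (qsForm L) (σ T u' s).1 ((eT T i s : ↥(Subgroup.centralizer ({γc T i} : Set (Gqs L v)))) : Gqs L v) : ℤ) : ℂ) = 0)
    (hdiag : ∀ T ∈ SH, ∀ (s : ↥T), IsLocalGRegular L v (s : ((UnitaryGroup.cmDatum L 2 (Matrix.of fun i j : Fin 2 => if i.val + j.val + 1 = 2 then (1 : L) else 0)).Local v × (UnitaryGroup.cmDatum L 1 (Matrix.of fun i j : Fin 1 => if i.val + j.val + 1 = 1 then (1 : L) else 0)).Local v)) → ∀ u : Fin (cQ T),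
      ∑ i : Fin (n T), ((finKappaAt L v (qsForm L) (σ T u s).1 ((eT T i s : ↥(Subgroup.centralizer ({γc T i} : Set (Gqs L v)))) : Gqs L v) : ℤ) : ℂ) * ((finKappaAt L v (qsForm L) (σ T u s).1 ((eT T i s : ↥(Subgroup.centralizer ({γc T i} : Set (Gqs L v)))) : Gqs L v) : ℤ) : ℂ) = (n T : ℂ))
    -- (E6) INDEX TWO (Lemma 3.6.1)
    (hnm : ∀ T ∈ SH, n T = 2 * m T)
    -- (E7) the `G`-singular part of each `H`-Cartan is null
    (hsingH : ∀ T ∈ SH, tH T {s : ↥T | ¬ IsLocalGRegular L v (s : ((UnitaryGroup.cmDatum L 2 (Matrix.of fun i j : Fin 2 => if i.val + j.val + 1 = 2 then (1 : L) else 0)).Local v × (UnitaryGroup.cmDatum L 1 (Matrix.of fun i j : Fin 1 => if i.val + j.val + 1 = 1 then (1 : L) else 0)).Local v))} = 0)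
    -- (E0) G-REGROUP (its conclusion, for every admissible `Φ`, at these letters) and its transport companion
    (hE0 : ∀ Φ : Gqs L v → ℂ, (∀ x y : Gqs L v, IsConj x y → Φ x = Φ y) →
      (∀ x : Gqs L v, (¬ ∃ q : ((UnitaryGroup.cmDatum L 2 (Matrix.of fun i j : Fin 2 => if i.val + j.val + 1 = 2 then (1 : L) else 0)).Local v × (UnitaryGroup.cmDatum L 1 (Matrix.of fun i j : Fin 1 => if i.val + j.val + 1 = 1 then (1 : L) else 0)).Local v), IsLocalGRegular L v q ∧ IsLocalNormPair L (qsForm L) v q x) → Φ x = 0) →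
      (∀ T' ∈ Sell, Integrable (fun t : ↥T' => Φ (t : Gqs L v)) (μTf T')) →
      ∑ T' ∈ Sell, (((T'.subgroupOf (Subgroup.normalizer (T' : Set (Gqs L v)))).index : ℂ))⁻¹ * ∫ t : ↥T', Φ (t : Gqs L v) ∂(μTf T') =
        ∑ T ∈ SH, ((((T.subgroupOf (Subgroup.normalizer (T : Set ((UnitaryGroup.cmDatum L 2 (Matrix.of fun i j : Fin 2 => if i.val + j.val + 1 = 2 then (1 : L) else 0)).Local v × (UnitaryGroup.cmDatum L 1 (Matrix.of fun i j : Fin 1 => if i.val + j.val + 1 = 1 then (1 : L) else 0)).Local v)))).index : ℂ))⁻¹ * ((m T : ℂ))⁻¹ * ((cQ T : ℂ))⁻¹) *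
          ∑ i : Fin (n T), ∫ s in {s : ↥T | IsLocalGRegular L v (s : ((UnitaryGroup.cmDatum L 2 (Matrix.of fun i j : Fin 2 => if i.val + j.val + 1 = 2 then (1 : L) else 0)).Local v × (UnitaryGroup.cmDatum L 1 (Matrix.of fun i j : Fin 1 => if i.val + j.val + 1 = 1 then (1 : L) else 0)).Local v))}, Φ ((eT T i s : ↥(Subgroup.centralizer ({γc T i} : Set (Gqs L v)))) : Gqs L v) ∂(tH T))
    (hE0i : ∀ Φ : Gqs L v → ℂ, (∀ x y : Gqs L v, IsConj x y → Φ x = Φ y) →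
      (∀ x : Gqs L v, (¬ ∃ q : ((UnitaryGroup.cmDatum L 2 (Matrix.of fun i j : Fin 2 => if i.val + j.val + 1 = 2 then (1 : L) else 0)).Local v × (UnitaryGroup.cmDatum L 1 (Matrix.of fun i j : Fin 1 => if i.val + j.val + 1 = 1 then (1 : L) else 0)).Local v), IsLocalGRegular L v q ∧ IsLocalNormPair L (qsForm L) v q x) → Φ x = 0) →
      (∀ T' ∈ Sell, Integrable (fun t : ↥T' => Φ (t : Gqs L v)) (μTf T')) →
      ∀ T ∈ SH, ∀ i : Fin (n T), IntegrableOn (fun s : ↥T => Φ ((eT T i s : ↥(Subgroup.centralizer ({γc T i} : Set (Gqs L v)))) : Gqs L v)) {s : ↥T | IsLocalGRegular L v (s : ((UnitaryGroup.cmDatum L 2 (Matrix.of fun i j : Fin 2 => if i.val + j.val + 1 = 2 then (1 : L) else 0)).Local v × (UnitaryGroup.cmDatum L 1 (Matrix.of fun i j : Fin 1 => if i.val + j.val + 1 = 1 then (1 : L) else 0)).Local v))} (tH T))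
    -- the data of Prop. 12.5.2 under the pins: stable class functions on the `G`-regular ELLIPTIC set of `H_v`, and the two GIVEN totals
    (α₁ α₂ : ((UnitaryGroup.cmDatum L 2 (Matrix.of fun i j : Fin 2 => if i.val + j.val + 1 = 2 then (1 : L) else 0)).Local v × (UnitaryGroup.cmDatum L 1 (Matrix.of fun i j : Fin 1 => if i.val + j.val + 1 = 1 then (1 : L) else 0)).Local v) → ℂ)
    (hα₁st : Ch12Sec5.IsStableClassFunOn (IsLocalStablyConjH L v) {a : ((UnitaryGroup.cmDatum L 2 (Matrix.of fun i j : Fin 2 => if i.val + j.val + 1 = 2 then (1 : L) else 0)).Local v × (UnitaryGroup.cmDatum L 1 (Matrix.of fun i j : Fin 1 => if i.val + j.val + 1 = 1 then (1 : L) else 0)).Local v) | IsLocalGRegular L v a ∧ IsCompact ((Subgroup.centralizer ({a} : Set ((UnitaryGroup.cmDatum L 2 (Matrix.of fun i j : Fin 2 => if i.val + j.val + 1 = 2 then (1 : L) else 0)).Local v × (UnitaryGroup.cmDatum L 1 (Matrix.of fun i j : Fin 1 => if i.val + j.val + 1 = 1 then (1 : L) else 0)).Local v)) : Subgroup ((UnitaryGroup.cmDatum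 L 2 (Matrix.of fun i j : Fin 2 => if i.val + j.val + 1 = 2 then (1 : L) else 0)).Local v × (UnitaryGroup.cmDatum L 1 (Matrix.of fun i j : Fin 1 => if i.val + j.val + 1 = 1 then (1 : L) else 0)).Local v)) : Set ((UnitaryGroup.cmDatum L 2 (Matrix.of fun i j : Fin 2 => if i.val + j.val + 1 = 2 then (1 : L) else 0)).Local v × (UnitaryGroup.cmDatum L 1 (Matrix.of fun i j : Fin 1 => if i.val + j.val + 1 = 1 then (1 : L) else 0)).Local v))} α₁)
    (hα₂st : Ch12Sec5.IsStableClassFunOn (IsLocalStablyConjH L v) {a : ((UnitaryGroup.cmDatum L 2 (Matrix.of fun i j : Fin 2 => if i.val + j.val + 1 = 2 then (1 : L) else 0)).Local v × (UnitaryGroup.cmDatum L 1 (Matrix.of fun i j : Fin 1 => if i.val + j.val + 1 = 1 then (1 : L) else 0)).Local v) | IsLocalGRegular L v a ∧ IsCompact ((Subgroup.centralizer ({a} : Set ((UnitaryGroup.cmDatum L 2 (Matrix.of fun i j : Fin 2 => if i.val + j.val + 1 = 2 then (1 : L) else 0)).Local v × (UnitaryGroup.cmDatum L 1 (Matrix.of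 fun i j : Fin 1 => if i.val + j.val + 1 = 1 then (1 : L) else 0)).Local v)) : Subgroup ((UnitaryGroup.cmDatum L 2 (Matrix.of fun i j : Fin 2 => if i.val + j.val + 1 = 2 then (1 : L) else 0)).Local v × (UnitaryGroup.cmDatum L 1 (Matrix.of fun i j : Fin 1 => if i.val + j.val + 1 = 1 then (1 : L) else 0)).Local v)) : Set ((UnitaryGroup.cmDatum L 2 (Matrix.of fun i j : Fin 2 => if i.val + j.val + 1 = 2 then (1 : L) else 0)).Local v × (UnitaryGroup.cmDatum L 1 (Matrix.of fun i j : Fin 1 => if i.val + j.val + 1 = 1 then (1 : L) else 0)).Local v))} α₂)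
    (hIG : ∀ T' ∈ Sell, Integrable (fun t : ↥T' => ((dG (t : Gqs L v) : ℂ)) ^ 2 * (if IsRegularElt (((t : Gqs L v)).val : GL (Fin 3) (UnitaryGroup.LocalRing L v)) then ((dG (t : Gqs L v) : ℂ))⁻¹ * ∑ᶠ q : Quot (IsLocalStablyConjH L v), (if IsLocalGRegular L v q.out ∧ IsLocalNormPair L (qsForm L) v q.out (t : Gqs L v) then finTau L v q.out μ * (dH q.out : ℂ) * ((finKappaAt L v (qsForm L) q.out (t : Gqs L v) : ℤ) : ℂ) * α₁ q.out else 0) else 0) * starRingEnd ℂ (if IsRegularElt (((t : Gqs L v)).val : GL (Fin 3) (UnitaryGroup.LocalRing L v)) then ((dG (t : Gqs L v) : ℂ))⁻¹ * ∑ᶠ q : Quot (IsLocalStablyConjH L v), (if IsLocalGRegular L v q.out ∧ IsLocalNormPair L (qsForm L) v q.out (t : Gqs L v) then finTau L v q.out μ * (dH q.out : ℂ) * ((finKappaAt L v (qsForm L) q.out (t : Gqs L v) : ℤ) : ℂ) * α₂ q.out else 0) else 0)) (μTf T'))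
    (hIH : ∀ T ∈ SH, Integrable (fun s : ↥T => ((dH (s : ((UnitaryGroup.cmDatum L 2 (Matrix.of fun i j : Fin 2 => if i.val + j.val + 1 = 2 then (1 : L) else 0)).Local v × (UnitaryGroup.cmDatum L 1 (Matrix.of fun i j : Fin 1 => if i.val + j.val + 1 = 1 then (1 : L) else 0)).Local v)) : ℂ)) ^ 2 * α₁ (s : ((UnitaryGroup.cmDatum L 2 (Matrix.of fun i j : Fin 2 => if i.val + j.val + 1 = 2 then (1 : L) else 0)).Local v × (UnitaryGroup.cmDatum L 1 (Matrix.of fun i j : Fin 1 => if i.val + j.val + 1 = 1 then (1 : L) else 0)).Local v)) * starRingEnd ℂ (α₂ (s : ((UnitaryGroup.cmDatum L 2 (Matrix.of fun i j : Fin 2 => if i.val + j.val + 1 = 2 then (1 : L) else 0)).Local v × (UnitaryGroup.cmDatum L 1 (Matrix.of fun i j : Fin 1 => if i.val + j.val + 1 = 1 then (1 : L) else 0)).Local v)))) (tH T)) :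
    ∑ T' ∈ Sell, (((T'.subgroupOf (Subgroup.normalizer (T' : Set (Gqs L v)))).index : ℂ))⁻¹ * ∫ t : ↥T', ((dG (t : Gqs L v) : ℂ)) ^ 2 * (if IsRegularElt (((t : Gqs L v)).val : GL (Fin 3) (UnitaryGroup.LocalRing L v)) then ((dG (t : Gqs L v) : ℂ))⁻¹ * ∑ᶠ q : Quot (IsLocalStablyConjH L v), (if IsLocalGRegular L v q.out ∧ IsLocalNormPair L (qsForm L) v q.out (t : Gqs L v) then finTau L v q.out μ * (dH q.out : ℂ) * ((finKappaAt L v (qsForm L) q.out (t : Gqs L v) : ℤ) : ℂ) * α₁ q.out else 0) else 0) * starRingEnd ℂ (if IsRegularElt (((t : Gqs L v)).val : GL (Fin 3) (UnitaryGroup.LocalRing L v)) then ((dG (t : Gqs L v) : ℂ))⁻¹ * ∑ᶠ q : Quot (IsLocalStablyConjH L v), (if IsLocalGRegular L v q.out ∧ IsLocalNormPair L (qsForm L) v q.out (t : Gqs L v) then finTau L v q.out μ * (dH q.out : ℂ) * ((finKappaAt L v (qsForm L) q.out (t : Gqs L v) : ℤ) : ℂ) * α₂ q.out else 0) else 0)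 ∂(μTf T') =
      2 * ∑ T ∈ SH, (((T.subgroupOf (Subgroup.normalizer (T : Set ((UnitaryGroup.cmDatum L 2 (Matrix.of fun i j : Fin 2 => if i.val + j.val + 1 = 2 then (1 : L) else 0)).Local v × (UnitaryGroup.cmDatum L 1 (Matrix.of fun i j : Fin 1 => if i.val + j.val + 1 = 1 then (1 : L) else 0)).Local v)))).index : ℂ))⁻¹ * ∫ s : ↥T, ((dH (s : ((UnitaryGroup.cmDatum L 2 (Matrix.of fun i j : Fin 2 => if i.val + j.val + 1 = 2 then (1 : L) else 0)).Local v × (UnitaryGroup.cmDatum L 1 (Matrix.of fun i j : Fin 1 => if i.val + j.val + 1 = 1 then (1 : L) else 0)).Local v)) : ℂ)) ^ 2 * α₁ (s : ((UnitaryGroup.cmDatum L 2 (Matrix.of fun i j : Fin 2 => if i.val + j.val + 1 = 2 then (1 : L) else 0)).Local v × (UnitaryGroup.cmDatum L 1 (Matrix.of fun i j : Fin 1 => if i.val + j.val + 1 = 1 then (1 : L) else 0)).Local v)) * starRingEnd ℂ (α₂ (s : ((UnitaryGroup.cmDatum L 2 (Matrix.of fun i j : Fin 2 => if i.val + j.val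 + 1 = 2 then (1 : L) else 0)).Local v × (UnitaryGroup.cmDatum L 1 (Matrix.of fun i j : Fin 1 => if i.val + j.val + 1 = 1 then (1 : L) else 0)).Local v))) ∂(tH T) := by
  -- ### the integrand `Φ` and the two up-functions, named locally
  set up₁ : Gqs L v → ℂ := fun x => (if IsRegularElt ((x).val : GL (Fin 3) (UnitaryGroup.LocalRing L v)) then ((dG x : ℂ))⁻¹ * ∑ᶠ q : Quot (IsLocalStablyConjH L v), (if IsLocalGRegular L v q.out ∧ IsLocalNormPair L (qsForm L) v q.out x then finTau L v q.out μ * (dH q.out : ℂ) * ((finKappaAt L v (qsForm L) q.out x : ℤ) : ℂ) * α₁ q.out else 0) else 0) with hup₁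
  set up₂ : Gqs L v → ℂ := fun x => (if IsRegularElt ((x).val : GL (Fin 3) (UnitaryGroup.LocalRing L v)) then ((dG x : ℂ))⁻¹ * ∑ᶠ q : Quot (IsLocalStablyConjH L v), (if IsLocalGRegular L v q.out ∧ IsLocalNormPair L (qsForm L) v q.out x then finTau L v q.out μ * (dH q.out : ℂ) * ((finKappaAt L v (qsForm L) q.out x : ℤ) : ℂ) * α₂ q.out else 0) else 0) with hup₂
  set Φ : Gqs L v → ℂ := fun x => ((dG x : ℂ)) ^ 2 * up₁ x * starRingEnd ℂ (up₂ x) with hΦ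
  show ∑ T' ∈ Sell, (((T'.subgroupOf (Subgroup.normalizer (T' : Set (Gqs L v)))).index : ℂ))⁻¹ * ∫ t : ↥T', Φ (t : Gqs L v) ∂(μTf T') = _
  -- ### the relation letters
  have hst_symm : ∀ {a b : ((UnitaryGroup.cmDatum L 2 (Matrix.of fun i j : Fin 2 => if i.val + j.val + 1 = 2 then (1 : L) else 0)).Local v × (UnitaryGroup.cmDatum L 1 (Matrix.of fun i j : Fin 1 => if i.val + j.val + 1 = 1 then (1 : L) else 0)).Local v)}, IsLocalStablyConjH L v a b → IsLocalStablyConjH L v b a := fun h => h.symm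
  have hst_trans : ∀ {a b c : ((UnitaryGroup.cmDatum L 2 (Matrix.of fun i j : Fin 2 => if i.val + j.val + 1 = 2 then (1 : L) else 0)).Local v × (UnitaryGroup.cmDatum L 1 (Matrix.of fun i j : Fin 1 => if i.val + j.val + 1 = 1 then (1 : L) else 0)).Local v)}, IsLocalStablyConjH L v a b → IsLocalStablyConjH L v b c → IsLocalStablyConjH L v a c := fun h h' => h.trans h'
  -- ### (i) the up-functions are class functions on `G`, and vanish off the matched set
  have hup_conj : ∀ (α : ((UnitaryGroup.cmDatum L 2 (Matrix.of fun i j : Fin 2 => if i.val + j.val + 1 = 2 then (1 : L) else 0)).Local v × (UnitaryGroup.cmDatum L 1 (Matrix.of fun i j : Fin 1 => if i.val + j.val + 1 = 1 then (1 : L) else 0)).Local v) → ℂ) (x c : Gqs L v),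
      (if IsRegularElt (((c * x * c⁻¹)).val : GL (Fin 3) (UnitaryGroup.LocalRing L v)) then ((dG (c * x * c⁻¹) : ℂ))⁻¹ * ∑ᶠ q : Quot (IsLocalStablyConjH L v), (if IsLocalGRegular L v q.out ∧ IsLocalNormPair L (qsForm L) v q.out (c * x * c⁻¹) then finTau L v q.out μ * (dH q.out : ℂ) * ((finKappaAt L v (qsForm L) q.out (c * x * c⁻¹) : ℤ) : ℂ) * α q.out else 0) else 0) = (if IsRegularElt ((x).val : GL (Fin 3) (UnitaryGroup.LocalRing L v)) then ((dG x : ℂ))⁻¹ * ∑ᶠ q : Quot (IsLocalStablyConjH L v), (if IsLocalGRegular L v q.out ∧ IsLocalNormPair L (qsForm L) v q.out x then finTau L v q.out μ * (dH q.out : ℂ) * ((finKappaAt L v (qsForm L) q.out x : ℤ) : ℂ) * α q.out else 0) else 0) := by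
    intro α x c
    have hreg : IsRegularElt ((c * x * c⁻¹).val : GL (Fin 3) (UnitaryGroup.LocalRing L v)) ↔ IsRegularElt ((x).val : GL (Fin 3) (UnitaryGroup.LocalRing L v)) := isRegularElt_conj_val_iff L v c x
    by_cases hx : IsRegularElt ((x).val : GL (Fin 3) (UnitaryGroup.LocalRing L v))
    · rw [if_pos (hreg.2 hx), if_pos hx, hdG]
      congr 1
      refine finsum_congr fun q => ?_
      by_cases hR : IsLocalNormPair L (qsForm L) v q.out x
      · have hR' : IsLocalNormPair L (qsForm L) v q.out (c * x * c⁻¹) :=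
          F0P3cStCharTSUpTrClaimP.isLocalNormPair_of_isConj_right L v q.out (isConj_iff.2 ⟨c, rfl⟩) hR
        simp only [hR, hR', and_true, finKappaAt_conj_right L v (qsForm L) q.out x c hR]
      · have hR' : ¬ IsLocalNormPair L (qsForm L) v q.out (c * x * c⁻¹) := fun h =>
          hR (F0P3cStCharTSUpTrClaimP.isLocalNormPair_of_isConj_right L v q.out (isConj_iff.2 ⟨c, rfl⟩ : IsConj x (c * x * c⁻¹)).symm h)
        simp only [hR, hR', and_false, if_false]
    · rw [if_neg (fun h => hx (hreg.1 h)), if_neg hx]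
  have hup₁c : ∀ x c : Gqs L v, up₁ (c * x * c⁻¹) = up₁ x := fun x c => hup_conj α₁ x c
  have hup₂c : ∀ x c : Gqs L v, up₂ (c * x * c⁻¹) = up₂ x := fun x c => hup_conj α₂ x c
  have hΦc : ∀ x y : Gqs L v, IsConj x y → Φ x = Φ y := by
    intro x y hxy
    obtain ⟨c, rfl⟩ := isConj_iff.1 hxy
    show ((dG x : ℂ)) ^ 2 * up₁ x * starRingEnd ℂ (up₂ x) = ((dG (c * x * c⁻¹) : ℂ)) ^ 2 * up₁ (c * x * c⁻¹) * starRingEnd ℂ (up₂ (c * x * c⁻¹))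
    rw [hup₁c, hup₂c, hdG]
  have hup_zero : ∀ (α : ((UnitaryGroup.cmDatum L 2 (Matrix.of fun i j : Fin 2 => if i.val + j.val + 1 = 2 then (1 : L) else 0)).Local v × (UnitaryGroup.cmDatum L 1 (Matrix.of fun i j : Fin 1 => if i.val + j.val + 1 = 1 then (1 : L) else 0)).Local v) → ℂ) (x : Gqs L v), (¬ ∃ q : ((UnitaryGroup.cmDatum L 2 (Matrix.of fun i j : Fin 2 => if i.val + j.val + 1 = 2 then (1 : L) else 0)).Local v × (UnitaryGroup.cmDatum L 1 (Matrix.of fun i j : Fin 1 => if i.val + j.val + 1 = 1 then (1 : L) else 0)).Local v), IsLocalGRegular L v q ∧ IsLocalNormPair L (qsForm L) v q x) →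
      (if IsRegularElt ((x).val : GL (Fin 3) (UnitaryGroup.LocalRing L v)) then ((dG x : ℂ))⁻¹ * ∑ᶠ q : Quot (IsLocalStablyConjH L v), (if IsLocalGRegular L v q.out ∧ IsLocalNormPair L (qsForm L) v q.out x then finTau L v q.out μ * (dH q.out : ℂ) * ((finKappaAt L v (qsForm L) q.out x : ℤ) : ℂ) * α q.out else 0) else 0) = 0 := by
    intro α x hx
    have h0 : (∑ᶠ q : Quot (IsLocalStablyConjH L v), (if IsLocalGRegular L v q.out ∧ IsLocalNormPair L (qsForm L) v q.out x then finTau L v q.out μ * (dH q.out : ℂ) * ((finKappaAt L v (qsForm L) q.out x : ℤ) : ℂ) * α q.out else 0)) = 0 :=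
      finsum_eq_zero_of_forall_eq_zero fun q => if_neg fun hq => hx ⟨q.out, hq⟩
    rw [h0, mul_zero, ite_self]
  have hΦ0 : ∀ x : Gqs L v, (¬ ∃ q : ((UnitaryGroup.cmDatum L 2 (Matrix.of fun i j : Fin 2 => if i.val + j.val + 1 = 2 then (1 : L) else 0)).Local v × (UnitaryGroup.cmDatum L 1 (Matrix.of fun i j : Fin 1 => if i.val + j.val + 1 = 1 then (1 : L) else 0)).Local v), IsLocalGRegular L v q ∧ IsLocalNormPair L (qsForm L) v q x) → Φ x = 0 := by
    intro x hx
    have h1 : up₁ x = 0 := hup_zero α₁ x hx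
    show ((dG x : ℂ)) ^ 2 * up₁ x * starRingEnd ℂ (up₂ x) = 0
    rw [h1, mul_zero, zero_mul]
  -- ### (ii) (E0): regroup the `G`-side over the `H`-Cartan system
  rw [hE0 Φ hΦc hΦ0 hIG, Finset.mul_sum]
  refine Finset.sum_congr rfl fun T hT => ?_
  -- ### (iii) per member `T ∈ SH`
  obtain ⟨γ₀, hγ₀, hTeq⟩ := hZ T hT
  have hγ₀T : γ₀ ∈ T := by rw [hTeq]; exact Subgroup.mem_centralizer_singleton_iff.2 rfl  -- `γ₀` commutes with itself
  -- `m T ≠ 0`, `n T ≠ 0`, `cQ T ≠ 0`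
  have hm0 : m T ≠ 0 := by
    obtain ⟨C, -, -, hCexh, hCcard⟩ := hclasses T hT γ₀ hγ₀T hγ₀
    obtain ⟨x, hx, -⟩ := hCexh γ₀ (IsStablyConjH.refl _ _ _ γ₀)
    rw [← hCcard]
    exact Finset.card_ne_zero.2 ⟨x, hx⟩
  have hn0 : n T ≠ 0 := by rw [hnm T hT]; omega
  have hc0 : cQ T ≠ 0 := by
    obtain ⟨i₀⟩ : Nonempty (Fin (n T)) := ⟨⟨0, Nat.pos_of_ne_zero hn0⟩⟩
    obtain ⟨u, -⟩ := hσexh T hT i₀ ⟨γ₀, hγ₀T⟩ hγ₀ γ₀ hγ₀ (heT T hT i₀ ⟨γ₀, hγ₀T⟩)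
    exact Fin.pos_iff_nonempty.2 ⟨u⟩ |>.ne'
  -- the `G`-regular set of `T` has full `tH T`-measure
  have hae : ∀ᵐ s ∂(tH T), IsLocalGRegular L v ((s : ↥T) : ((UnitaryGroup.cmDatum L 2 (Matrix.of fun i j : Fin 2 => if i.val + j.val + 1 = 2 then (1 : L) else 0)).Local v × (UnitaryGroup.cmDatum L 1 (Matrix.of fun i j : Fin 1 => if i.val + j.val + 1 = 1 then (1 : L) else 0)).Local v)) := by
    have h := (measure_eq_zero_iff_ae_notMem (μ := tH T)).1 (hsingH T hT)
    filter_upwards [h] with s hs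
    simpa using hs
  have hres : (tH T).restrict {s : ↥T | IsLocalGRegular L v (s : ((UnitaryGroup.cmDatum L 2 (Matrix.of fun i j : Fin 2 => if i.val + j.val + 1 = 2 then (1 : L) else 0)).Local v × (UnitaryGroup.cmDatum L 1 (Matrix.of fun i j : Fin 1 => if i.val + j.val + 1 = 1 then (1 : L) else 0)).Local v))} = tH T := Measure.restrict_eq_self_of_ae_mem hae
  simp_rw [hres]
  -- integrability of the pieces (a CONCLUSION of (E0), fence (γ)) and of the `H`-side total
  have hint : ∀ i : Fin (n T), Integrable (fun s : ↥T => Φ ((eT T i s : ↥(Subgroup.centralizer ({γc T i} : Set (Gqs L v)))) : Gqs L v)) (tH T) := by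
    intro i
    have h := hE0i Φ hΦc hΦ0 hIG T hT i
    rwa [IntegrableOn, hres] at h
  have hF := hIH T hT
  -- ### (iv) the pointwise identity at a `G`-regular `s ∈ T`: `Σ_i Φ(e_i s) = n T · Σ_u F(σ_u s)`
  have hpt : ∀ s : ↥T, IsLocalGRegular L v (s : ((UnitaryGroup.cmDatum L 2 (Matrix.of fun i j : Fin 2 => if i.val + j.val + 1 = 2 then (1 : L) else 0)).Local v × (UnitaryGroup.cmDatum L 1 (Matrix.of fun i j : Fin 1 => if i.val + j.val + 1 = 1 then (1 : L) else 0)).Local v)) →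
      ∑ i : Fin (n T), Φ ((eT T i s : ↥(Subgroup.centralizer ({γc T i} : Set (Gqs L v)))) : Gqs L v) =
        (n T : ℂ) * ∑ u : Fin (cQ T), ((dH ((σ T u s) : ((UnitaryGroup.cmDatum L 2 (Matrix.of fun i j : Fin 2 => if i.val + j.val + 1 = 2 then (1 : L) else 0)).Local v × (UnitaryGroup.cmDatum L 1 (Matrix.of fun i j : Fin 1 => if i.val + j.val + 1 = 1 then (1 : L) else 0)).Local v)) : ℂ)) ^ 2 * α₁ ((σ T u s) : ((UnitaryGroup.cmDatum L 2 (Matrix.of fun i j : Fin 2 => if i.val + j.val + 1 = 2 then (1 : L) else 0)).Local v × (UnitaryGroup.cmDatum L 1 (Matrix.of fun i j : Fin 1 => if i.val + j.val + 1 = 1 then (1 : L) else 0)).Local v)) * starRingEnd ℂ (α₂ ((σ T u s) : ((UnitaryGroup.cmDatum L 2 (Matrix.of fun i j : Fin 2 => if i.val + j.val + 1 = 2 then (1 : L) else 0)).Local v × (UnitaryGroup.cmDatum L 1 (Matrix.of fun i j : Fin 1 => if i.val + j.val + 1 = 1 then (1 : L) else 0)).Local v))) := by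
    intro s hs
    -- the slots are `G`-regular points of the compact Cartan `T`: the stable class functions are constant on their stable classes
    have hgood : ∀ u : Fin (cQ T), ((σ T u s) : ((UnitaryGroup.cmDatum L 2 (Matrix.of fun i j : Fin 2 => if i.val + j.val + 1 = 2 then (1 : L) else 0)).Local v × (UnitaryGroup.cmDatum L 1 (Matrix.of fun i j : Fin 1 => if i.val + j.val + 1 = 1 then (1 : L) else 0)).Local v)) ∈ {a : ((UnitaryGroup.cmDatum L 2 (Matrix.of fun i j : Fin 2 => if i.val + j.val + 1 = 2 then (1 : L) else 0)).Local v × (UnitaryGroup.cmDatum L 1 (Matrix.of fun i j : Fin 1 => if i.val + j.val + 1 = 1 then (1 : L) else 0)).Local v) | IsLocalGRegular L v a ∧ IsCompact ((Subgroup.centralizer ({a} : Set ((UnitaryGroup.cmDatum L 2 (Matrix.of fun i j : Fin 2 => if i.val + j.val + 1 = 2 then (1 : L) else 0)).Local v × (UnitaryGroup.cmDatum L 1 (Matrix.of fun i j : Fin 1 => if i.val + j.val + 1 = 1 then (1 : L) else 0)).Local v)) : Subgroup ((UnitaryGroup.cmDatum L 2 (Matrix.of fun i j : Fin 2 => if i.val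 + j.val + 1 = 2 then (1 : L) else 0)).Local v × (UnitaryGroup.cmDatum L 1 (Matrix.of fun i j : Fin 1 => if i.val + j.val + 1 = 1 then (1 : L) else 0)).Local v)) : Set ((UnitaryGroup.cmDatum L 2 (Matrix.of fun i j : Fin 2 => if i.val + j.val + 1 = 2 then (1 : L) else 0)).Local v × (UnitaryGroup.cmDatum L 1 (Matrix.of fun i j : Fin 1 => if i.val + j.val + 1 = 1 then (1 : L) else 0)).Local v))} := by
      intro u
      refine ⟨hσreg T hT u s hs, ?_⟩
      rw [F0P3cStCharTSUpTrCartanFields.centralizer_eq_cartan_of_isLocalGRegular hγ₀ hTeq (σ T u s) (hσreg T hT u s hs)]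
      exact hKH T hT
    -- the transversal as a `Finset` of `H_v`
    have hinjσ : Function.Injective (fun u : Fin (cQ T) => ((σ T u s) : ((UnitaryGroup.cmDatum L 2 (Matrix.of fun i j : Fin 2 => if i.val + j.val + 1 = 2 then (1 : L) else 0)).Local v × (UnitaryGroup.cmDatum L 1 (Matrix.of fun i j : Fin 1 => if i.val + j.val + 1 = 1 then (1 : L) else 0)).Local v))) := by
      intro u u' h
      dsimp only at h
      by_contra hne
      exact hσpair T hT s hs u u' hne (by rw [h]; exact IsStablyConjH.refl _ _ _ _)
    -- per embedding `i`: UP-EVAL on the transversal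
    have hupi : ∀ (α : ((UnitaryGroup.cmDatum L 2 (Matrix.of fun i j : Fin 2 => if i.val + j.val + 1 = 2 then (1 : L) else 0)).Local v × (UnitaryGroup.cmDatum L 1 (Matrix.of fun i j : Fin 1 => if i.val + j.val + 1 = 1 then (1 : L) else 0)).Local v) → ℂ), Ch12Sec5.IsStableClassFunOn (IsLocalStablyConjH L v) {a : ((UnitaryGroup.cmDatum L 2 (Matrix.of fun i j : Fin 2 => if i.val + j.val + 1 = 2 then (1 : L) else 0)).Local v × (UnitaryGroup.cmDatum L 1 (Matrix.of fun i j : Fin 1 => if i.val + j.val + 1 = 1 then (1 : L) else 0)).Local v) | IsLocalGRegular L v a ∧ IsCompact ((Subgroup.centralizer ({a} : Set ((UnitaryGroup.cmDatum L 2 (Matrix.of fun i j : Fin 2 => if i.val + j.val + 1 = 2 then (1 : L) else 0)).Local v × (UnitaryGroup.cmDatum L 1 (Matrix.of fun i j : Fin 1 => if i.val + j.val + 1 = 1 then (1 : L) else 0)).Local v)) : Subgroup ((UnitaryGroup.cmDatum L 2 (Matrix.of fun i j : Fin 2 => if i.val + j.val + 1 = 2 then (1 : L) else 0)).Local v ×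 (UnitaryGroup.cmDatum L 1 (Matrix.of fun i j : Fin 1 => if i.val + j.val + 1 = 1 then (1 : L) else 0)).Local v)) : Set ((UnitaryGroup.cmDatum L 2 (Matrix.of fun i j : Fin 2 => if i.val + j.val + 1 = 2 then (1 : L) else 0)).Local v × (UnitaryGroup.cmDatum L 1 (Matrix.of fun i j : Fin 1 => if i.val + j.val + 1 = 1 then (1 : L) else 0)).Local v))} α →
        ∀ i : Fin (n T),
          (if IsRegularElt ((((eT T i s : ↥(Subgroup.centralizer ({γc T i} : Set (Gqs L v)))) : Gqs L v)).val : GL (Fin 3) (UnitaryGroup.LocalRing L v)) then ((dG ((eT T i s : ↥(Subgroup.centralizer ({γc T i} : Set (Gqs L v)))) : Gqs L v) : ℂ))⁻¹ * ∑ᶠ q : Quot (IsLocalStablyConjH L v), (if IsLocalGRegular L v q.out ∧ IsLocalNormPair L (qsForm L) v q.out ((eT T i s : ↥(Subgroup.centralizer ({γc T i} : Set (Gqs L v)))) : Gqs L v) then finTau L v q.out μ * (dH q.out : ℂ) * ((finKappaAt L v (qsForm L) q.out ((eT T i s : ↥(Subgroup.centralizer ({γc T i} : Set (Gqs L v))))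 : Gqs L v) : ℤ) : ℂ) * α q.out else 0) else 0) =
            ((dG ((eT T i s : ↥(Subgroup.centralizer ({γc T i} : Set (Gqs L v)))) : Gqs L v) : ℂ))⁻¹ * ∑ u : Fin (cQ T), finTau L v ((σ T u s) : ((UnitaryGroup.cmDatum L 2 (Matrix.of fun i j : Fin 2 => if i.val + j.val + 1 = 2 then (1 : L) else 0)).Local v × (UnitaryGroup.cmDatum L 1 (Matrix.of fun i j : Fin 1 => if i.val + j.val + 1 = 1 then (1 : L) else 0)).Local v)) μ * (dH ((σ T u s) : ((UnitaryGroup.cmDatum L 2 (Matrix.of fun i j : Fin 2 => if i.val + j.val + 1 = 2 then (1 : L) else 0)).Local v × (UnitaryGroup.cmDatum L 1 (Matrix.of fun i j : Fin 1 => if i.val + j.val + 1 = 1 then (1 : L) else 0)).Local v)) : ℂ) * ((finKappaAt L v (qsForm L) ((σ T u s) : ((UnitaryGroup.cmDatum L 2 (Matrix.of fun i j : Fin 2 => if i.val + j.val + 1 = 2 then (1 : L) else 0)).Local v × (UnitaryGroup.cmDatum L 1 (Matrix.of fun i j : Fin 1 => if i.val + j.val + 1 = 1 then (1 : L) else 0)).Local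 v)) ((eT T i s : ↥(Subgroup.centralizer ({γc T i} : Set (Gqs L v)))) : Gqs L v) : ℤ) : ℂ) * α ((σ T u s) : ((UnitaryGroup.cmDatum L 2 (Matrix.of fun i j : Fin 2 => if i.val + j.val + 1 = 2 then (1 : L) else 0)).Local v × (UnitaryGroup.cmDatum L 1 (Matrix.of fun i j : Fin 1 => if i.val + j.val + 1 = 1 then (1 : L) else 0)).Local v)) := by
      intro α hαst i
      have hxreg : IsRegularElt ((((eT T i s : ↥(Subgroup.centralizer ({γc T i} : Set (Gqs L v)))) : Gqs L v)).val : GL (Fin 3) (UnitaryGroup.LocalRing L v)) := (isLocalGRegular_iff_isRegularElt_of_isLocalNormPair L v (heT T hT i s)).1 hs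
      rw [if_pos hxreg]
      congr 1
      -- the summand, extended by `0` off the fibre, is stable on `G`-regular classes
      have key := finsum_quot_eq_sum L v ((eT T i s : ↥(Subgroup.centralizer ({γc T i} : Set (Gqs L v)))) : Gqs L v)
        (fun a => if IsLocalGRegular L v a ∧ IsLocalNormPair L (qsForm L) v a ((eT T i s : ↥(Subgroup.centralizer ({γc T i} : Set (Gqs L v)))) : Gqs L v) then finTau L v a μ * (dH a : ℂ) * ((finKappaAt L v (qsForm L) a ((eT T i s : ↥(Subgroup.centralizer ({γc T i} : Set (Gqs L v)))) : Gqs L v) : ℤ) : ℂ) * α a else 0)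
        (fun a b ha hab => ?_)
        ((Finset.univ : Finset (Fin (cQ T))).image (fun u : Fin (cQ T) => ((σ T u s) : ((UnitaryGroup.cmDatum L 2 (Matrix.of fun i j : Fin 2 => if i.val + j.val + 1 = 2 then (1 : L) else 0)).Local v × (UnitaryGroup.cmDatum L 1 (Matrix.of fun i j : Fin 1 => if i.val + j.val + 1 = 1 then (1 : L) else 0)).Local v))))
        (fun t ht => ?_) (fun t ht t' ht' hne => ?_) (fun a ha hR => ?_)
      · -- read `key`
        rw [Finset.sum_image (fun u _ u' _ h => hinjσ h)] at key
        refine (finsum_congr fun q => ?_).trans (key.trans (Finset.sum_congr rfl fun u _ => ?_))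
        · by_cases hq : IsLocalGRegular L v q.out ∧ IsLocalNormPair L (qsForm L) v q.out ((eT T i s : ↥(Subgroup.centralizer ({γc T i} : Set (Gqs L v)))) : Gqs L v)
          · simp only [hq, and_self, if_true]
          · simp only [hq, if_false]
        · rw [if_pos ⟨hσreg T hT u s hs, hσR T hT u i s hs⟩]
      · -- stability of the extended summand
        by_cases hc : IsLocalGRegular L v a ∧ IsLocalNormPair L (qsForm L) v a ((eT T i s : ↥(Subgroup.centralizer ({γc T i} : Set (Gqs L v)))) : Gqs L v)
        · have hb : IsLocalGRegular L v b ∧ IsLocalNormPair L (qsForm L) v b ((eT T i s : ↥(Subgroup.centralizer ({γc T i} : Set (Gqs L v)))) : Gqs L v) :=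
            ⟨isLocalGRegular_of_isLocalStablyConjH L v ha hab, (isLocalNormPair_iff_of_isLocalStablyConjH L v (qsForm L) hab _).2 hc.2⟩
          obtain ⟨u, hu⟩ := hσexh T hT i s hs a hc.1 hc.2
          have hαa : α a = α ((σ T u s) : ((UnitaryGroup.cmDatum L 2 (Matrix.of fun i j : Fin 2 => if i.val + j.val + 1 = 2 then (1 : L) else 0)).Local v × (UnitaryGroup.cmDatum L 1 (Matrix.of fun i j : Fin 1 => if i.val + j.val + 1 = 1 then (1 : L) else 0)).Local v)) := hαst.2 _ (hgood u) a (hst_symm hu)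
          have hαb : α b = α ((σ T u s) : ((UnitaryGroup.cmDatum L 2 (Matrix.of fun i j : Fin 2 => if i.val + j.val + 1 = 2 then (1 : L) else 0)).Local v × (UnitaryGroup.cmDatum L 1 (Matrix.of fun i j : Fin 1 => if i.val + j.val + 1 = 1 then (1 : L) else 0)).Local v)) := hαst.2 _ (hgood u) b (hst_trans (hst_symm hu) hab)
          rw [if_pos hc, if_pos hb, finTau_eq_of_isLocalStablyConjH L v hab μ, finKappaAt_eq_of_isLocalStablyConjH L v (qsForm L) hab, hDHst a b ha hab, hαb, hαa]
        · have hb : ¬ (IsLocalGRegular L v b ∧ IsLocalNormPair L (qsForm L) v b ((eT T i s : ↥(Subgroup.centralizer ({γc T i} : Set (Gqs L v)))) : Gqs L v)) := fun hb =>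
            hc ⟨ha, (isLocalNormPair_iff_of_isLocalStablyConjH L v (qsForm L) hab _).1 hb.2⟩
          rw [if_neg hc, if_neg hb]
      · -- members of the transversal are `G`-regular and matched
        obtain ⟨u, -, rfl⟩ := Finset.mem_image.1 ht
        exact ⟨hσreg T hT u s hs, hσR T hT u i s hs⟩
      · -- distinct members are not stably conjugate
        obtain ⟨u, -, rfl⟩ := Finset.mem_image.1 ht
        obtain ⟨u', -, rfl⟩ := Finset.mem_image.1 ht'
        exact hσpair T hT s hs u u' (fun h => hne (by rw [h]))
      · -- exhaustion
        obtain ⟨u, hu⟩ := hσexh T hT i s hs a ha hR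
        exact ⟨(σ T u s : ((UnitaryGroup.cmDatum L 2 (Matrix.of fun i j : Fin 2 => if i.val + j.val + 1 = 2 then (1 : L) else 0)).Local v × (UnitaryGroup.cmDatum L 1 (Matrix.of fun i j : Fin 1 => if i.val + j.val + 1 = 1 then (1 : L) else 0)).Local v)), Finset.mem_image.2 ⟨u, Finset.mem_univ u, rfl⟩, hu⟩
    -- expand `Φ(e_i s)` and swap the sums
    have hxreg : ∀ i : Fin (n T), IsRegularElt ((((eT T i s : ↥(Subgroup.centralizer ({γc T i} : Set (Gqs L v)))) : Gqs L v)).val : GL (Fin 3) (UnitaryGroup.LocalRing L v)) := fun i =>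
      (isLocalGRegular_iff_isRegularElt_of_isLocalNormPair L v (heT T hT i s)).1 hs
    set cc : Fin (cQ T) → Fin (cQ T) → ℂ := fun u u' => (finTau L v ((σ T u s) : ((UnitaryGroup.cmDatum L 2 (Matrix.of fun i j : Fin 2 => if i.val + j.val + 1 = 2 then (1 : L) else 0)).Local v × (UnitaryGroup.cmDatum L 1 (Matrix.of fun i j : Fin 1 => if i.val + j.val + 1 = 1 then (1 : L) else 0)).Local v)) μ * starRingEnd ℂ (finTau L v ((σ T u' s) : ((UnitaryGroup.cmDatum L 2 (Matrix.of fun i j : Fin 2 => if i.val + j.val + 1 = 2 then (1 : L) else 0)).Local v × (UnitaryGroup.cmDatum L 1 (Matrix.of fun i j : Fin 1 => if i.val + j.val + 1 = 1 then (1 : L) else 0)).Local v)) μ) * ((dH ((σ T u s) : ((UnitaryGroup.cmDatum L 2 (Matrix.of fun i j : Fin 2 => if i.val + j.val + 1 = 2 then (1 : L) else 0)).Local v × (UnitaryGroup.cmDatum L 1 (Matrix.of fun i j : Fin 1 => if i.val + j.val + 1 = 1 then (1 : L) else 0)).Local v)) : ℂ)) * ((dH ((σ T u' s) : ((UnitaryGroup.cmDatum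 L 2 (Matrix.of fun i j : Fin 2 => if i.val + j.val + 1 = 2 then (1 : L) else 0)).Local v × (UnitaryGroup.cmDatum L 1 (Matrix.of fun i j : Fin 1 => if i.val + j.val + 1 = 1 then (1 : L) else 0)).Local v)) : ℂ)) * α₁ ((σ T u s) : ((UnitaryGroup.cmDatum L 2 (Matrix.of fun i j : Fin 2 => if i.val + j.val + 1 = 2 then (1 : L) else 0)).Local v × (UnitaryGroup.cmDatum L 1 (Matrix.of fun i j : Fin 1 => if i.val + j.val + 1 = 1 then (1 : L) else 0)).Local v)) * starRingEnd ℂ (α₂ ((σ T u' s) : ((UnitaryGroup.cmDatum L 2 (Matrix.of fun i j : Fin 2 => if i.val + j.val + 1 = 2 then (1 : L) else 0)).Local v × (UnitaryGroup.cmDatum L 1 (Matrix.of fun i j : Fin 1 => if i.val + j.val + 1 = 1 then (1 : L) else 0)).Local v)))) with hcc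
    set kk : Fin (n T) → Fin (cQ T) → Fin (cQ T) → ℂ := fun i u u' => ((finKappaAt L v (qsForm L) (σ T u s).1 ((eT T i s : ↥(Subgroup.centralizer ({γc T i} : Set (Gqs L v)))) : Gqs L v) : ℤ) : ℂ) * ((finKappaAt L v (qsForm L) (σ T u' s).1 ((eT T i s : ↥(Subgroup.centralizer ({γc T i} : Set (Gqs L v)))) : Gqs L v) : ℤ) : ℂ) with hkk
    have hΦi : ∀ i : Fin (n T), Φ ((eT T i s : ↥(Subgroup.centralizer ({γc T i} : Set (Gqs L v)))) : Gqs L v) = ∑ u : Fin (cQ T), ∑ u' : Fin (cQ T), cc u u' * kk i u u' := by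
      intro i
      show ((dG ((eT T i s : ↥(Subgroup.centralizer ({γc T i} : Set (Gqs L v)))) : Gqs L v) : ℂ)) ^ 2 * (if IsRegularElt ((((eT T i s : ↥(Subgroup.centralizer ({γc T i} : Set (Gqs L v)))) : Gqs L v)).val : GL (Fin 3) (UnitaryGroup.LocalRing L v)) then ((dG ((eT T i s : ↥(Subgroup.centralizer ({γc T i} : Set (Gqs L v)))) : Gqs L v) : ℂ))⁻¹ * ∑ᶠ q : Quot (IsLocalStablyConjH L v), (if IsLocalGRegular L v q.out ∧ IsLocalNormPair L (qsForm L) v q.out ((eT T i s : ↥(Subgroup.centralizer ({γc T i} : Set (Gqs L v)))) : Gqs L v) then finTau L v q.out μ * (dH q.out : ℂ) * ((finKappaAt L v (qsForm L) q.out ((eT T i s : ↥(Subgroup.centralizer ({γc T i} : Set (Gqs L v)))) : Gqs L v) : ℤ) : ℂ) * α₁ q.out else 0) else 0) * starRingEnd ℂ (if IsRegularElt ((((eT T i s : ↥(Subgroup.centralizer ({γc T i} : Set (Gqs L v)))) : Gqs L v)).val : GL (Fin 3) (UnitaryGroup.LocalRing L v)) then ((dG ((eT T i s : ↥(Subgroup.centralizer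 ({γc T i} : Set (Gqs L v)))) : Gqs L v) : ℂ))⁻¹ * ∑ᶠ q : Quot (IsLocalStablyConjH L v), (if IsLocalGRegular L v q.out ∧ IsLocalNormPair L (qsForm L) v q.out ((eT T i s : ↥(Subgroup.centralizer ({γc T i} : Set (Gqs L v)))) : Gqs L v) then finTau L v q.out μ * (dH q.out : ℂ) * ((finKappaAt L v (qsForm L) q.out ((eT T i s : ↥(Subgroup.centralizer ({γc T i} : Set (Gqs L v)))) : Gqs L v) : ℤ) : ℂ) * α₂ q.out else 0) else 0) = _
      rw [hupi α₁ hα₁st i, hupi α₂ hα₂st i, sq_mul_inv_mul_mul_conj_inv_mul (hdG0 _ (hxreg i)), _root_.map_sum, Finset.sum_mul_sum]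
      refine Finset.sum_congr rfl fun u _ => Finset.sum_congr rfl fun u' _ => ?_
      simp only [hcc, hkk, map_mul, Complex.conj_ofReal, map_intCast]
      ring
    have hK0 : ∀ u u' : Fin (cQ T), u ≠ u' → ∑ i : Fin (n T), kk i u u' = 0 := fun u u' hne => hcross T hT s hs u u' hne
    have hKd : ∀ u : Fin (cQ T), ∑ i : Fin (n T), kk i u u = (n T : ℂ) := fun u => hdiag T hT s hs u
    have hdiagc : ∀ u : Fin (cQ T), cc u u = ((dH ((σ T u s) : ((UnitaryGroup.cmDatum L 2 (Matrix.of fun i j : Fin 2 => if i.val + j.val + 1 = 2 then (1 : L) else 0)).Local v × (UnitaryGroup.cmDatum L 1 (Matrix.of fun i j : Fin 1 => if i.val + j.val + 1 = 1 then (1 : L) else 0)).Local v)) : ℂ)) ^ 2 * α₁ ((σ T u s) : ((UnitaryGroup.cmDatum L 2 (Matrix.of fun i j : Fin 2 => if i.val + j.val + 1 = 2 then (1 : L) else 0)).Local v × (UnitaryGroup.cmDatum L 1 (Matrix.of fun i j : Fin 1 => if i.val + j.val + 1 = 1 then (1 : L) else 0)).Local v)) * starRingEnd ℂ (α₂ ((σ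 T u s) : ((UnitaryGroup.cmDatum L 2 (Matrix.of fun i j : Fin 2 => if i.val + j.val + 1 = 2 then (1 : L) else 0)).Local v × (UnitaryGroup.cmDatum L 1 (Matrix.of fun i j : Fin 1 => if i.val + j.val + 1 = 1 then (1 : L) else 0)).Local v))) := by
      intro u
      show (finTau L v ((σ T u s) : ((UnitaryGroup.cmDatum L 2 (Matrix.of fun i j : Fin 2 => if i.val + j.val + 1 = 2 then (1 : L) else 0)).Local v × (UnitaryGroup.cmDatum L 1 (Matrix.of fun i j : Fin 1 => if i.val + j.val + 1 = 1 then (1 : L) else 0)).Local v)) μ * starRingEnd ℂ (finTau L v ((σ T u s) : ((UnitaryGroup.cmDatum L 2 (Matrix.of fun i j : Fin 2 => if i.val + j.val + 1 = 2 then (1 : L) else 0)).Local v × (UnitaryGroup.cmDatum L 1 (Matrix.of fun i j : Fin 1 => if i.val + j.val + 1 = 1 then (1 : L) else 0)).Local v)) μ) * ((dH ((σ T u s) : ((UnitaryGroup.cmDatum L 2 (Matrix.of fun i j : Fin 2 => if i.val + j.val + 1 = 2 then (1 : L) else 0)).Local v × (UnitaryGroup.cmDatum L 1 (Matrix.of fun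 i j : Fin 1 => if i.val + j.val + 1 = 1 then (1 : L) else 0)).Local v)) : ℂ)) * ((dH ((σ T u s) : ((UnitaryGroup.cmDatum L 2 (Matrix.of fun i j : Fin 2 => if i.val + j.val + 1 = 2 then (1 : L) else 0)).Local v × (UnitaryGroup.cmDatum L 1 (Matrix.of fun i j : Fin 1 => if i.val + j.val + 1 = 1 then (1 : L) else 0)).Local v)) : ℂ)) * α₁ ((σ T u s) : ((UnitaryGroup.cmDatum L 2 (Matrix.of fun i j : Fin 2 => if i.val + j.val + 1 = 2 then (1 : L) else 0)).Local v × (UnitaryGroup.cmDatum L 1 (Matrix.of fun i j : Fin 1 => if i.val + j.val + 1 = 1 then (1 : L) else 0)).Local v)) * starRingEnd ℂ (α₂ ((σ T u s) : ((UnitaryGroup.cmDatum L 2 (Matrix.of fun i j : Fin 2 => if i.val + j.val + 1 = 2 then (1 : L) else 0)).Local v × (UnitaryGroup.cmDatum L 1 (Matrix.of fun i j : Fin 1 => if i.val + j.val + 1 = 1 then (1 : L) else 0)).Local v)))) = _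
      rw [show (finTau L v ((σ T u s) : ((UnitaryGroup.cmDatum L 2 (Matrix.of fun i j : Fin 2 => if i.val + j.val + 1 = 2 then (1 : L) else 0)).Local v × (UnitaryGroup.cmDatum L 1 (Matrix.of fun i j : Fin 1 => if i.val + j.val + 1 = 1 then (1 : L) else 0)).Local v)) μ * starRingEnd ℂ (finTau L v ((σ T u s) : ((UnitaryGroup.cmDatum L 2 (Matrix.of fun i j : Fin 2 => if i.val + j.val + 1 = 2 then (1 : L) else 0)).Local v × (UnitaryGroup.cmDatum L 1 (Matrix.of fun i j : Fin 1 => if i.val + j.val + 1 = 1 then (1 : L) else 0)).Local v)) μ) * ((dH ((σ T u s) : ((UnitaryGroup.cmDatum L 2 (Matrix.of fun i j : Fin 2 => if i.val + j.val + 1 = 2 then (1 : L) else 0)).Local v × (UnitaryGroup.cmDatum L 1 (Matrix.of fun i j : Fin 1 => if i.val + j.val + 1 = 1 then (1 : L) else 0)).Local v)) : ℂ)) * ((dH ((σ T u s) : ((UnitaryGroup.cmDatum L 2 (Matrix.of fun i j : Fin 2 => if i.val + j.val + 1 = 2 then (1 : L) else 0)).Local v × (UnitaryGroup.cmDatum L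 1 (Matrix.of fun i j : Fin 1 => if i.val + j.val + 1 = 1 then (1 : L) else 0)).Local v)) : ℂ)) * α₁ ((σ T u s) : ((UnitaryGroup.cmDatum L 2 (Matrix.of fun i j : Fin 2 => if i.val + j.val + 1 = 2 then (1 : L) else 0)).Local v × (UnitaryGroup.cmDatum L 1 (Matrix.of fun i j : Fin 1 => if i.val + j.val + 1 = 1 then (1 : L) else 0)).Local v)) * starRingEnd ℂ (α₂ ((σ T u s) : ((UnitaryGroup.cmDatum L 2 (Matrix.of fun i j : Fin 2 => if i.val + j.val + 1 = 2 then (1 : L) else 0)).Local v × (UnitaryGroup.cmDatum L 1 (Matrix.of fun i j : Fin 1 => if i.val + j.val + 1 = 1 then (1 : L) else 0)).Local v)))) =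
          (finTau L v ((σ T u s) : ((UnitaryGroup.cmDatum L 2 (Matrix.of fun i j : Fin 2 => if i.val + j.val + 1 = 2 then (1 : L) else 0)).Local v × (UnitaryGroup.cmDatum L 1 (Matrix.of fun i j : Fin 1 => if i.val + j.val + 1 = 1 then (1 : L) else 0)).Local v)) μ * starRingEnd ℂ (finTau L v ((σ T u s) : ((UnitaryGroup.cmDatum L 2 (Matrix.of fun i j : Fin 2 => if i.val + j.val + 1 = 2 then (1 : L) else 0)).Local v × (UnitaryGroup.cmDatum L 1 (Matrix.of fun i j : Fin 1 => if i.val + j.val + 1 = 1 then (1 : L) else 0)).Local v)) μ)) * (((dH ((σ T u s) : ((UnitaryGroup.cmDatum L 2 (Matrix.of fun i j : Fin 2 => if i.val + j.val + 1 = 2 then (1 : L) else 0)).Local v × (UnitaryGroup.cmDatum L 1 (Matrix.of fun i j : Fin 1 => if i.val + j.val + 1 = 1 then (1 : L) else 0)).Local v)) : ℂ)) ^ 2 * α₁ ((σ T u s) : ((UnitaryGroup.cmDatum L 2 (Matrix.of fun i j : Fin 2 => if i.val + j.val + 1 = 2 then (1 : L) else 0)).Local v × (UnitaryGroup.cmDatum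 L 1 (Matrix.of fun i j : Fin 1 => if i.val + j.val + 1 = 1 then (1 : L) else 0)).Local v)) * starRingEnd ℂ (α₂ ((σ T u s) : ((UnitaryGroup.cmDatum L 2 (Matrix.of fun i j : Fin 2 => if i.val + j.val + 1 = 2 then (1 : L) else 0)).Local v × (UnitaryGroup.cmDatum L 1 (Matrix.of fun i j : Fin 1 => if i.val + j.val + 1 = 1 then (1 : L) else 0)).Local v)))) by ring,
        hτ _ (hσreg T hT u s hs), one_mul]
    calc ∑ i : Fin (n T), Φ ((eT T i s : ↥(Subgroup.centralizer ({γc T i} : Set (Gqs L v)))) : Gqs L v)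
        = ∑ i : Fin (n T), ∑ u : Fin (cQ T), ∑ u' : Fin (cQ T), cc u u' * kk i u u' := Finset.sum_congr rfl fun i _ => hΦi i
      _ = ∑ u : Fin (cQ T), ∑ u' : Fin (cQ T), cc u u' * ∑ i : Fin (n T), kk i u u' := by
          rw [Finset.sum_comm]
          refine Finset.sum_congr rfl fun u _ => ?_
          rw [Finset.sum_comm]
          exact Finset.sum_congr rfl fun u' _ => by rw [Finset.mul_sum]
      _ = (n T : ℂ) * ∑ u : Fin (cQ T), cc u u := sum_sum_mul_eq_mul_sum_diag cc (fun u u' => ∑ i : Fin (n T), kk i u u') (n T : ℂ) hK0 hKd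
      _ = (n T : ℂ) * ∑ u : Fin (cQ T), ((dH ((σ T u s) : ((UnitaryGroup.cmDatum L 2 (Matrix.of fun i j : Fin 2 => if i.val + j.val + 1 = 2 then (1 : L) else 0)).Local v × (UnitaryGroup.cmDatum L 1 (Matrix.of fun i j : Fin 1 => if i.val + j.val + 1 = 1 then (1 : L) else 0)).Local v)) : ℂ)) ^ 2 * α₁ ((σ T u s) : ((UnitaryGroup.cmDatum L 2 (Matrix.of fun i j : Fin 2 => if i.val + j.val + 1 = 2 then (1 : L) else 0)).Local v × (UnitaryGroup.cmDatum L 1 (Matrix.of fun i j : Fin 1 => if i.val + j.val + 1 = 1 then (1 : L) else 0)).Local v)) * starRingEnd ℂ (α₂ ((σ T u s) : ((UnitaryGroup.cmDatum L 2 (Matrix.of fun i j : Fin 2 => if i.val + j.val + 1 = 2 then (1 : L) else 0)).Local v × (UnitaryGroup.cmDatum L 1 (Matrix.of fun i j : Fin 1 => if i.val + j.val + 1 = 1 then (1 : L) else 0)).Local v))) := by rw [Finset.sum_congr rfl fun u _ => hdiagc u]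
  -- ### (v) integrate: `Σ_i ∫ Φ∘e_i = ∫ Σ_i Φ∘e_i = n T · Σ_u ∫ F∘σ_u = n T · cQ T · ∫ F`
  rw [← integral_finsetSum Finset.univ (fun i _ => hint i)]
  rw [integral_congr_ae (hae.mono fun s hs => hpt s hs)]
  have hFσ : ∀ u : Fin (cQ T), Integrable (fun s : ↥T => ((dH ((σ T u s) : ((UnitaryGroup.cmDatum L 2 (Matrix.of fun i j : Fin 2 => if i.val + j.val + 1 = 2 then (1 : L) else 0)).Local v × (UnitaryGroup.cmDatum L 1 (Matrix.of fun i j : Fin 1 => if i.val + j.val + 1 = 1 then (1 : L) else 0)).Local v)) : ℂ)) ^ 2 * α₁ ((σ T u s) : ((UnitaryGroup.cmDatum L 2 (Matrix.of fun i j : Fin 2 => if i.val + j.val + 1 = 2 then (1 : L) else 0)).Local v × (UnitaryGroup.cmDatum L 1 (Matrix.of fun i j : Fin 1 => if i.val + j.val + 1 = 1 then (1 : L) else 0)).Local v)) * starRingEnd ℂ (α₂ ((σ T u s) : ((UnitaryGroup.cmDatum L 2 (Matrix.of fun i j : Fin 2 => if i.val + j.val + 1 = 2 then (1 : L) else 0)).Local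 v × (UnitaryGroup.cmDatum L 1 (Matrix.of fun i j : Fin 1 => if i.val + j.val + 1 = 1 then (1 : L) else 0)).Local v)))) (tH T) :=
    fun u => ((hσm T hT u).integrable_comp hF.aestronglyMeasurable).2 hF
  have hIσ : ∀ u : Fin (cQ T), ∫ s : ↥T, ((dH ((σ T u s) : ((UnitaryGroup.cmDatum L 2 (Matrix.of fun i j : Fin 2 => if i.val + j.val + 1 = 2 then (1 : L) else 0)).Local v × (UnitaryGroup.cmDatum L 1 (Matrix.of fun i j : Fin 1 => if i.val + j.val + 1 = 1 then (1 : L) else 0)).Local v)) : ℂ)) ^ 2 * α₁ ((σ T u s) : ((UnitaryGroup.cmDatum L 2 (Matrix.of fun i j : Fin 2 => if i.val + j.val + 1 = 2 then (1 : L) else 0)).Local v × (UnitaryGroup.cmDatum L 1 (Matrix.of fun i j : Fin 1 => if i.val + j.val + 1 = 1 then (1 : L) else 0)).Local v)) * starRingEnd ℂ (α₂ ((σ T u s) : ((UnitaryGroup.cmDatum L 2 (Matrix.of fun i j : Fin 2 => if i.val + j.val + 1 = 2 then (1 : L) else 0)).Local v × (UnitaryGroup.cmDatum L 1 (Matrix.of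 fun i j : Fin 1 => if i.val + j.val + 1 = 1 then (1 : L) else 0)).Local v))) ∂(tH T) =
      ∫ s : ↥T, ((dH (s : ((UnitaryGroup.cmDatum L 2 (Matrix.of fun i j : Fin 2 => if i.val + j.val + 1 = 2 then (1 : L) else 0)).Local v × (UnitaryGroup.cmDatum L 1 (Matrix.of fun i j : Fin 1 => if i.val + j.val + 1 = 1 then (1 : L) else 0)).Local v)) : ℂ)) ^ 2 * α₁ (s : ((UnitaryGroup.cmDatum L 2 (Matrix.of fun i j : Fin 2 => if i.val + j.val + 1 = 2 then (1 : L) else 0)).Local v × (UnitaryGroup.cmDatum L 1 (Matrix.of fun i j : Fin 1 => if i.val + j.val + 1 = 1 then (1 : L) else 0)).Local v)) * starRingEnd ℂ (α₂ (s : ((UnitaryGroup.cmDatum L 2 (Matrix.of fun i j : Fin 2 => if i.val + j.val + 1 = 2 then (1 : L) else 0)).Local v × (UnitaryGroup.cmDatum L 1 (Matrix.of fun i j : Fin 1 => if i.val + j.val + 1 = 1 then (1 : L) else 0)).Local v))) ∂(tH T) := by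
    intro u
    have h := integral_map (hσm T hT u).measurable.aemeasurable (f := fun s : ↥T => ((dH (s : ((UnitaryGroup.cmDatum L 2 (Matrix.of fun i j : Fin 2 => if i.val + j.val + 1 = 2 then (1 : L) else 0)).Local v × (UnitaryGroup.cmDatum L 1 (Matrix.of fun i j : Fin 1 => if i.val + j.val + 1 = 1 then (1 : L) else 0)).Local v)) : ℂ)) ^ 2 * α₁ (s : ((UnitaryGroup.cmDatum L 2 (Matrix.of fun i j : Fin 2 => if i.val + j.val + 1 = 2 then (1 : L) else 0)).Local v × (UnitaryGroup.cmDatum L 1 (Matrix.of fun i j : Fin 1 => if i.val + j.val + 1 = 1 then (1 : L) else 0)).Local v)) * starRingEnd ℂ (α₂ (s : ((UnitaryGroup.cmDatum L 2 (Matrix.of fun i j : Fin 2 => if i.val + j.val + 1 = 2 then (1 : L) else 0)).Local v × (UnitaryGroup.cmDatum L 1 (Matrix.of fun i j : Fin 1 => if i.val + j.val + 1 = 1 then (1 : L) else 0)).Local v)))) (by rw [(hσm T hT u).map_eq]; exact hF.aestronglyMeasurable)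
    rw [(hσm T hT u).map_eq] at h
    exact h.symm
  rw [integral_const_mul, integral_finsetSum Finset.univ (fun u _ => hFσ u), Finset.sum_congr rfl fun u _ => hIσ u, Finset.sum_const, Finset.card_univ,
    Fintype.card_fin, nsmul_eq_mul]
  -- ### (vi) the scalars (§1)
  have hw := weight_mul_count_eq_two_mul ((T.subgroupOf (Subgroup.normalizer (T : Set ((UnitaryGroup.cmDatum L 2 (Matrix.of fun i j : Fin 2 => if i.val + j.val + 1 = 2 then (1 : L) else 0)).Local v × (UnitaryGroup.cmDatum L 1 (Matrix.of fun i j : Fin 1 => if i.val + j.val + 1 = 1 then (1 : L) else 0)).Local v)))).index) (m T) (cQ T) (n T) hm0 hc0 (hnm T hT)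
  linear_combination (∫ s : ↥T, ((dH (s : ((UnitaryGroup.cmDatum L 2 (Matrix.of fun i j : Fin 2 => if i.val + j.val + 1 = 2 then (1 : L) else 0)).Local v × (UnitaryGroup.cmDatum L 1 (Matrix.of fun i j : Fin 1 => if i.val + j.val + 1 = 1 then (1 : L) else 0)).Local v)) : ℂ)) ^ 2 * α₁ (s : ((UnitaryGroup.cmDatum L 2 (Matrix.of fun i j : Fin 2 => if i.val + j.val + 1 = 2 then (1 : L) else 0)).Local v × (UnitaryGroup.cmDatum L 1 (Matrix.of fun i j : Fin 1 => if i.val + j.val + 1 = 1 then (1 : L) else 0)).Local v)) * starRingEnd ℂ (α₂ (s : ((UnitaryGroup.cmDatum L 2 (Matrix.of fun i j : Fin 2 => if i.val + j.val + 1 = 2 then (1 : L) else 0)).Local v × (UnitaryGroup.cmDatum L 1 (Matrix.of fun i j : Fin 1 => if i.val + j.val + 1 = 1 then (1 : L) else 0)).Local v))) ∂(tH T)) * hw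

end CM

end Summit.HodgeConjecture.HodgeConjecture.Cruxes.H413.F0P3cStCharTSEllInnerAssembly

end
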